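import Literature.NumberTheory.LFunctions.VinogradovZetaSumBilinear
import Literature.NumberTheory.LFunctions.VinogradovZetaSumShift
import Literature.NumberTheory.LFunctions.ExpSumBoundReduction
import Literature.NumberTheory.LFunctions.VinogradovMeanValueHypothesis
import Literature.NumberTheory.LFunctions.VinogradovMeanValueBound
import HarnessLib

/-!
# Vinogradov's estimate for the zeta sums (Ivić 1985, Theorem 6.2, Korobov's method) and the
# Vinogradov–Korobov zero-free region for Dirichlet `L`-functions — unconditionally

Topic `Literature/NumberTheory/LFunctions`.  Everything in this file is PROVED; it introduces no named fact and
no hypothesis predicate (the `def`s are explicit real quantities of the proof: the coefficients `α_m(n)`, the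
factors `msN`, the majorants `θ_m`, `θ*`).  It completes, for the SHIFTED zeta sums `∑_{N<n≤R}(n+u)^{-it}`
(`0 < u ≤ 1`, the form needed for Hurwitz zeta / Dirichlet `L`-functions), the proof of

**Theorem 6.2** of A. Ivić, *The Riemann Zeta-Function* (Wiley 1985), p. 144 (proof §6.3, pp. 153–159):
`∑_{N<n≤N₁≤2N} n^{it} ≪ N exp(−log³N/(10⁵ log²t))`,

in the shape `Literature.NumberTheory.LFunctions.VinogradovRangeBound` consumed by the tree
(`ExpSumBoundReduction.lean`), from the pieces already in the tree: Vinogradov's mean value theorem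
(`VinogradovMeanValue{Count,Torus,StepA,Linnik,FirstClass,Bound}.lean`, Ivić's Lemmas 6.1–6.3, `VMV.lemma63`),
Vinogradov's shift and the Taylor step (`VinogradovZetaSumShift.lean`, Ivić (6.36)–(6.40)), Korobov's bound for
the bilinear sums (`VinogradovZetaSumBilinear.lean`), and Lemma 6.4 (`VinogradovZetaSumLemmas.lean`).

**Main results.**

* `vinogradovRangeBound_ivic` — **Theorem 6.2, unconditionally**: `VinogradovRangeBound 10 (e^{10} + 4) 10⁻⁶`, i.e.
  `‖∑_{N<n≤R} (n+u)^{-it}‖ ≤ (e^{10} + 4) N^{1 − 10⁻⁶ log²N/log²t}` for `1 ≤ N < R ≤ 2N`, `N^{21/2} ≤ t`,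
  `0 < u ≤ 1` (the bounded range `log t/log N ≤ 21/2` is van der Corput's, supplied by the tree's
  `expSumBound_of_vinogradovRange`);
* `expSumBound_ivic : ∃ C D, ExpSumBound C D` (Ford's Theorem 2 shape, all `1 ≤ N ≤ t`) and
  **`exists_hasVKZeroFreeRegion : ∃ c > 0, HasVKZeroFreeRegion c 21` — the Vinogradov–Korobov zero-free region
  `σ ≥ 1 − c/(log q + (log|t|)^{2/3}(log log|t|)^{1/3})`, `|t| ≥ 21`, for ALL Dirichlet `L`-functions (every
  modulus `q ≥ 3`), unconditionally** — through the tree's proved chain (`RichertBoundsFromExpSum.lean`,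
  `VinogradovKorobovFromRichert.lean`).  This discharges the input `HasVKZeroFreeRegion c T₀` of the twisted prime
  number theorem (`TwistedVonMangoldtSum.lean`) and of its users (Matomäki–Radziwiłł, Matomäki–Radziwiłł–Tao,
  Lichtman 2020, Harman's Gaussian primes: the `…_of_vk` / `…_of_vinogradovRange` theorems of the tree);
* `vinogradovRangeBound_of_vmvt`, `hasVKZeroFreeRegion_of_vmvt` — the same from the tree's interface predicate
  `VMVTBound A` (`VinogradovMeanValueHypothesis.lean`, the large-`P` form of Lemma 6.3 with constant `A`), for the
  record; the unconditional theorems do not go through it but through the instance `J_le_four` of `VMV.lemma63`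
  (whose constant `K(n,k)^r n^{2n²(n+1)}` is not of the uniform shape `(An)^{Akr}` but is `≤ (4r)^{4k(4r+1)}` at
  the parameters `n = r`, `k = 5r²`, `4r` iterations actually used, `K63_instance_le`).

**Proof** (Ivić pp. 153–159 with the shift `u` carried along; absolute constants cruder than Ivić's).
With `Y = log t/log N ≥ 10`, `L = log N`, `a = [N^{2/5}]`, `r = [5.01Y]`, the tree's `norm_zetaSum_le_shift` gives
`|S| ≤ a⁻²∑_n |U(n)| + 2Nt(a²/N)^{r+1} + 2a²` with the bilinear sums `U(n) = ∑_{x,y≤a} e(∑_m α_m(n)(xy)^m)`,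
`α_m(n) = (−1)^m t/(2πm(n+u)^m)` (`norm_doubleSum_eq_norm_Usum` identifies them with `VKZeta.Usum`).  Korobov's
bound (`VKZeta.norm_Usum_pow_le`): `|U|^{4k²} ≤ J_{k,r}(a)² a^{8k²−4k} ∏_m ∑_{|μ|<A_m} min(2A_m, 1/(2‖α_mμ‖))`,
`A_m = ka^m`, `k = 5r²`.  Every factor is `≤ (2A_m)²` (`msN_le_sq`); for `2Y < m ≤ 3.5Y` (Ivić uses `2Y < m ≤ 5Y`
and the exact sum over `m`; a termwise bound on the shorter range suffices) `1/|α_m| ≥ 4A_m`, so by the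
no-wrap-around case of Lemma 6.5 (`sum_geomBound_le_of_small`) the factor is `≤ (2A_m)² θ_m`,
`θ_m = L e^{6m} N^{m/5}/t ≤ θ* = L e^{21Y} N^{−3Y/10}` (`msN_le_good`, `good_core`); Lemma 6.3 bounds `J_{k,r}(a)`
(degree `r`, `4r` iterations, `k = r² + r·4r`, `(1 − 1/r)^{4r} ≤ e^{−4}`; `J_le_four`), and the exponent
bookkeeping of p. 158 (`numerics`) yields `|U(n)| ≤ a² e^{10} exp(−2·10⁻⁶ L/Y²)` in the range `L ≥ 10⁶ Y²`
(`norm_Usum_le`, `norm_zetaSum_le_main`); below that range the estimate is trivial.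

## References

* A. Ivić, *The Riemann Zeta-Function*, John Wiley & Sons 1985 (Dover 2003): §6.1 Theorems 6.1–6.2, (6.3)–(6.4)
  (pp. 143–144); §6.2 Lemma 6.3 (p. 151); §6.3 Lemmas 6.4–6.5 and the proof of Theorem 6.2, (6.36)–(6.46)
  (pp. 152–159). [Ivic1985]
* N. M. Korobov, *Exponential Sums and their Applications*, Kluwer 1992, Ch. II (the method). [Korobov1992]
* K. Ford, *Vinogradov's integral and bounds for the Riemann zeta function*, Proc. LMS 85 (2002), Theorems 2–3.
  [Ford2002]
* T. Khale, arXiv:2210.06457, (1.4) and Theorem B.1 (the shape `HasVKZeroFreeRegion`). [Khale2024]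
-/

noncomputable section

open Finset Real Complex

namespace Literature.NumberTheory.LFunctions

namespace VKZeta

open VMV VinogradovZetaSum Literature.NumberTheory.Sieve.Vinogradov
open scoped FourierTransform

/-! ### Sums over symmetric integer intervals and the used case of Ivić's Lemma 6.5 -/

/-- `[−(M+1), M+1] = {−(M+1), M+1} ∪ [−M, M]` in `ℤ`. [folklore] -/
theorem Icc_neg_succ (M : ℕ) :
    Icc (-((M + 1 : ℕ) : ℤ)) ((M + 1 : ℕ) : ℤ) =
      insert (-((M + 1 : ℕ) : ℤ)) (insert ((M + 1 : ℕ) : ℤ) (Icc (-(M : ℤ)) (M : ℤ))) := by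
  ext x
  simp only [mem_Icc, mem_insert]
  push_cast
  omega

/-- Folding a sum over `[−M, M] ⊂ ℤ` onto `[1, M]`:
`∑_{|m| ≤ M} F(m) = F(0) + ∑_{i<M} (F(i+1) + F(−(i+1)))`. [folklore] -/
theorem sum_Icc_neg_eq (F : ℤ → ℝ) (M : ℕ) :
    ∑ m ∈ Icc (-(M : ℤ)) (M : ℤ), F m =
      F 0 + ∑ i ∈ range M, (F ((i : ℤ) + 1) + F (-((i : ℤ) + 1))) := by
  induction M with
  | zero => simp
  | succ M ih =>
    rw [Icc_neg_succ, sum_insert, sum_insert, ih, sum_range_succ]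
    · push_cast; ring
    · simp only [mem_Icc]; push_cast; omega
    · simp only [mem_insert, mem_Icc]; push_cast; omega

/-- The harmonic bound `∑_{i<M} 1/(i+1) ≤ 1 + log M`, from Mathlib's `harmonic_le_one_add_log`.
[folklore] -/
theorem sum_range_inv_succ_le' (M : ℕ) :
    ∑ i ∈ range M, (1 : ℝ) / ((i : ℝ) + 1) ≤ 1 + Real.log M := by
  have h := harmonic_le_one_add_log M
  have e : ((harmonic M : ℚ) : ℝ) = ∑ i ∈ range M, (1 : ℝ) / ((i : ℝ) + 1) := by
    unfold harmonic
    push_cast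
    refine sum_congr rfl fun i _ => ?_
    rw [one_div]
  rwa [e] at h

/-- **The used case of Ivić's Lemma 6.5** (no wrap-around): if `α ≠ 0`, `A ≥ 1` and
`4A|α| ≤ 1`, then `∑_{|μ| ≤ A−1} min(2A, 1/(2‖αμ‖)) ≤ 2A + |α|⁻¹ (1 + log A)`: for `1 ≤ |μ| < A`
one has `|αμ| ≤ 1/4`, so `‖αμ‖ = |α||μ|` and the sum is `2A + |α|⁻¹ ∑_{μ<A} 1/μ`.  On p. 156 of
Ivić this is the range `q_m = [1/|α_m|] ≥ 4A_m` in which Lemma 6.5 is applied; it is the regime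
opposite to the tree's `Vinogradov.sum_geomBound_le_of_separated` (`m ≥ 1/(2δ)`), and sharper there than
the general `VinogradovZetaSum.sum_geomBound_linear_Icc_le`. [cite: Ivic1985, Lemma 6.5 and p. 156] -/
theorem sum_geomBound_le_of_small {α : ℝ} (hα : α ≠ 0) {A : ℕ} (hA : 1 ≤ A)
    (h4 : 4 * (A : ℝ) * |α| ≤ 1) :
    ∑ μ ∈ Icc (-((A - 1 : ℕ) : ℤ)) ((A - 1 : ℕ) : ℤ), geomBound (2 * A) (α * μ) ≤
      2 * A + 1 / |α| * (1 + Real.log A) := by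
  have hαpos : 0 < |α| := abs_pos.2 hα
  have hA' : ((A - 1 : ℕ) : ℝ) = A - 1 := by
    rw [Nat.cast_sub hA]; simp
  rw [sum_Icc_neg_eq]
  have h0 : geomBound (2 * (A : ℝ)) (α * ((0 : ℤ) : ℝ)) ≤ 2 * A := geomBound_le _ _
  have hterm : ∀ i ∈ range (A - 1), ∀ s : ℝ, (s = 1 ∨ s = -1) →
      geomBound (2 * (A : ℝ)) (α * (s * ((i : ℝ) + 1))) ≤ 1 / |α| * (1 / 2) * (1 / ((i : ℝ) + 1)) := by
    intro i hi s hs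
    have hi' : (i : ℝ) + 1 ≤ A - 1 := by
      have := mem_range.1 hi
      have : (i : ℝ) + 1 ≤ ((A - 1 : ℕ) : ℝ) := by exact_mod_cast this
      rwa [hA'] at this
    have hi0 : (0 : ℝ) < (i : ℝ) + 1 := by positivity
    have habs : |α * (s * ((i : ℝ) + 1))| = |α| * ((i : ℝ) + 1) := by
      rw [abs_mul, abs_mul]
      rcases hs with rfl | rfl <;> simp [abs_of_pos hi0]
    have hsmall : |α * (s * ((i : ℝ) + 1))| ≤ 1 / 2 := by
      rw [habs]
      have : |α| * ((i : ℝ) + 1) ≤ |α| * A := by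
        apply mul_le_mul_of_nonneg_left _ hαpos.le; linarith
      nlinarith
    have hdi : distInt (α * (s * ((i : ℝ) + 1))) = |α| * ((i : ℝ) + 1) := by
      rw [distInt_eq_abs_of_abs_le_half hsmall, habs]
    have hdi0 : 0 < distInt (α * (s * ((i : ℝ) + 1))) := by
      rw [hdi]; positivity
    refine (geomBound_le_inv _ hdi0).trans (le_of_eq ?_)
    rw [hdi]
    field_simp
  have hsum : ∑ i ∈ range (A - 1),
      (geomBound (2 * (A : ℝ)) (α * (((i : ℤ) + 1 : ℤ) : ℝ)) +
        geomBound (2 * (A : ℝ)) (α * ((-((i : ℤ) + 1) : ℤ) : ℝ)))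
      ≤ ∑ i ∈ range (A - 1), 1 / |α| * (1 / ((i : ℝ) + 1)) := by
    refine sum_le_sum fun i hi => ?_
    have h1 := hterm i hi 1 (Or.inl rfl)
    have h2 := hterm i hi (-1) (Or.inr rfl)
    have e1 : (((i : ℤ) + 1 : ℤ) : ℝ) = 1 * ((i : ℝ) + 1) := by push_cast; ring
    have e2 : ((-((i : ℤ) + 1) : ℤ) : ℝ) = -1 * ((i : ℝ) + 1) := by push_cast; ring
    rw [e1, e2]
    linarith
  have hharm := sum_range_inv_succ_le' (A - 1)
  have hlogmono : Real.log ((A - 1 : ℕ) : ℝ) ≤ Real.log A := by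
    rcases eq_or_lt_of_le hA with h | h
    · subst h; simp
    · apply Real.log_le_log
      · rw [hA']; have : (2 : ℝ) ≤ A := by exact_mod_cast h
        linarith
      · rw [hA']; linarith
  calc geomBound (2 * (A : ℝ)) (α * ((0 : ℤ) : ℝ)) + ∑ i ∈ range (A - 1),
        (geomBound (2 * (A : ℝ)) (α * (((i : ℤ) + 1 : ℤ) : ℝ)) +
          geomBound (2 * (A : ℝ)) (α * ((-((i : ℤ) + 1) : ℤ) : ℝ)))
      ≤ 2 * A + ∑ i ∈ range (A - 1), 1 / |α| * (1 / ((i : ℝ) + 1)) := add_le_add h0 hsum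
    _ = 2 * A + 1 / |α| * ∑ i ∈ range (A - 1), 1 / ((i : ℝ) + 1) := by rw [mul_sum]
    _ ≤ 2 * A + 1 / |α| * (1 + Real.log A) := by
        gcongr
        exact hharm.trans (by linarith)

/-! ### All factors: `∑_{|μ|<A_j} min(2A_j, ·) ≤ (2A_j)²` -/

/-- Every factor satisfies `∑_{|μ| ≤ A−1} min(2A, 1/(2‖α μ‖)) ≤ (2A − 1)·2A ≤ (2A)²`.
[cite: Ivic1985, p. 156 ("The last sum above is trivially `≤ (2A_m)²`")] -/
theorem mnSum_le_sq {r : ℕ} (k a : ℕ) (α : Fin r → ℝ) (j : Fin r) (hA : 1 ≤ Abnd k a j) :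
    mnSum k a α j ≤ (2 * (Abnd k a j : ℝ)) ^ 2 := by
  unfold mnSum
  have h1 : ∀ μ ∈ Icc (-((Abnd k a j - 1 : ℕ) : ℤ)) ((Abnd k a j - 1 : ℕ) : ℤ),
      geomBound (2 * (Abnd k a j : ℝ)) (α j * μ) ≤ 2 * (Abnd k a j : ℝ) := fun μ _ => geomBound_le _ _
  refine (sum_le_sum h1).trans ?_
  rw [sum_const, nsmul_eq_mul, card_Icc_neg, Nat.cast_sub hA]
  push_cast
  have : (0 : ℝ) ≤ Abnd k a j := by positivity
  nlinarith

/-! ### The coefficients `α_m(n)` and the factors as functions of `m = j + 1` -/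

/-- The coefficients `α_m = (−1)^m t/(2πm(n+u)^m)` of Ivić's (6.40) (for the phase `−t log`; index
`j : Fin r` stands for `m = j+1`), as in `VinogradovZetaSum.norm_zetaSum_le_shift`. [cite: Ivic1985, (6.40)] -/
def αv (t u : ℝ) (r : ℕ) (n : ℕ) : Fin r → ℝ := fun j =>
  -t * (-1) ^ (j.val) / (2 * π * ((j.val : ℝ) + 1) * ((n : ℝ) + u) ^ (j.val + 1))

/-- The double sum of `VinogradovZetaSum.norm_zetaSum_le_shift` is `VKZeta.Usum a (αv t u r n)` of
`VinogradovZetaSumBilinear.lean`. [folklore] -/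
theorem norm_doubleSum_eq_norm_Usum (t u : ℝ) (r a n : ℕ) :
    ‖∑ x ∈ Icc (1 : ℤ) a, ∑ y ∈ Icc (1 : ℤ) a,
        VdC.e (∑ j : Fin r, ((-1) ^ (j.val + 1) * t / (2 * π * (j.val + 1) * ((n : ℝ) + u) ^ (j.val + 1))) *
          ((x : ℝ) ^ (j.val + 1) * (y : ℝ) ^ (j.val + 1)))‖ = ‖Usum a (αv t u r n)‖ := by
  unfold Usum
  congr 1
  refine sum_congr rfl fun x _ => sum_congr rfl fun y _ => ?_
  rw [E_eq_e_sum]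
  congr 1
  refine sum_congr rfl fun j _ => ?_
  unfold nu αv
  push_cast
  rw [pow_succ (-1 : ℝ) j.val]
  ring

/-! ### The factors as functions of `m = j + 1` -/

/-- `α_m = (−1)^m t/(2πm(n+u)^m)` as a function of `m ∈ ℕ` (`VKZeta.αv … j = αN … (j+1)`).
[cite: Ivic1985, (6.40)] -/
def αN (t u : ℝ) (n m : ℕ) : ℝ := t * (-1) ^ m / (2 * π * m * ((n : ℝ) + u) ^ m)

/-- `αv t u r n j = αN t u n (j+1)`. [folklore] -/
theorem αv_eq_αN (t u : ℝ) (r n : ℕ) (j : Fin r) : αv t u r n j = αN t u n (j.val + 1) := by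
  unfold αv αN
  push_cast
  rw [pow_succ]
  ring

/-- The `m`-th factor `∑_{|μ| ≤ ka^m − 1} min(2ka^m, 1/(2‖α_m μ‖))` as a function of `m ∈ ℕ`.
[cite: Ivic1985, p. 156] -/
def msN (t u : ℝ) (k a n m : ℕ) : ℝ :=
  ∑ μ ∈ Icc (-((k * a ^ m - 1 : ℕ) : ℤ)) ((k * a ^ m - 1 : ℕ) : ℤ),
    geomBound (2 * ((k * a ^ m : ℕ) : ℝ)) (αN t u n m * μ)

/-- `mnSum k a (αv t u r n) j = msN t u k a n (j+1)`. [folklore] -/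
theorem mnSum_eq_msN (t u : ℝ) (r k a n : ℕ) (j : Fin r) :
    mnSum k a (αv t u r n) j = msN t u k a n (j.val + 1) := by
  unfold mnSum msN Abnd
  simp_rw [αv_eq_αN]

/-- `∏_{j : Fin r} mnSum_j = ∏_{i<r} msN(i+1)`. [folklore] -/
theorem prod_mnSum_eq (t u : ℝ) (r k a n : ℕ) :
    ∏ j : Fin r, mnSum k a (αv t u r n) j = ∏ i ∈ range r, msN t u k a n (i + 1) := by
  simp_rw [mnSum_eq_msN]
  exact Fin.prod_univ_eq_prod_range (fun i => msN t u k a n (i + 1)) r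

/-- `msN(m) ≤ (2ka^m)²` (`k, a ≥ 1`). [cite: Ivic1985, p. 156] -/
theorem msN_le_sq (t u : ℝ) {k a : ℕ} (hk : 1 ≤ k) (ha : 1 ≤ a) (n m : ℕ) :
    msN t u k a n m ≤ (2 * ((k * a ^ m : ℕ) : ℝ)) ^ 2 := by
  unfold msN
  have hA : 1 ≤ k * a ^ m := Nat.one_le_iff_ne_zero.2 (Nat.mul_ne_zero (Nat.one_le_iff_ne_zero.1 hk)
    (pow_ne_zero _ (Nat.one_le_iff_ne_zero.1 ha)))
  have h1 : ∀ μ ∈ Icc (-((k * a ^ m - 1 : ℕ) : ℤ)) ((k * a ^ m - 1 : ℕ) : ℤ),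
      geomBound (2 * ((k * a ^ m : ℕ) : ℝ)) (αN t u n m * μ) ≤ 2 * ((k * a ^ m : ℕ) : ℝ) :=
    fun μ _ => geomBound_le _ _
  refine (sum_le_sum h1).trans ?_
  rw [sum_const, nsmul_eq_mul, card_Icc_neg, Nat.cast_sub hA]
  push_cast
  have : (0 : ℝ) ≤ (k : ℝ) * (a : ℝ) ^ m := by positivity
  nlinarith

/-- `msN(m) ≥ 0`. [folklore] -/
theorem msN_nonneg (t u : ℝ) (k a n m : ℕ) : 0 ≤ msN t u k a n m :=
  sum_nonneg fun μ _ => geomBound_nonneg (by positivity) _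

/-! ### The product of the factors -/

/-- `∑_{i<r} 2(i+1) = r(r+1)`. [folklore] -/
theorem sum_range_two_mul_succ (r : ℕ) : ∑ i ∈ range r, (2 * ((i : ℝ) + 1)) = (r : ℝ) * (r + 1) := by
  induction r with
  | zero => simp
  | succ r ih => rw [sum_range_succ, ih]; push_cast; ring

/-- **The product step**: if every factor is `≤ (2ka^{i+1})²` and the factors with `M₂ ≤ i < M₃ ≤ r`
are `≤ (2ka^{i+1})² θ`, then `∏_{i<r} msN(i+1) ≤ (∏_{i<r} (2ka^{i+1})²) θ^{M₃ − M₂}`.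
[cite: Ivic1985, p. 156] -/
theorem prod_msN_le {t u θ : ℝ} {k a n r M₂ M₃ : ℕ} (hk : 1 ≤ k) (ha : 1 ≤ a) (hM : M₃ ≤ r)
    (hgood : ∀ i ∈ Ico M₂ M₃, msN t u k a n (i + 1) ≤ (2 * ((k * a ^ (i + 1) : ℕ) : ℝ)) ^ 2 * θ) :
    ∏ i ∈ range r, msN t u k a n (i + 1) ≤
      (∏ i ∈ range r, (2 * ((k * a ^ (i + 1) : ℕ) : ℝ)) ^ 2) * θ ^ (M₃ - M₂) := by
  classical
  set g : ℕ → ℝ := fun i => (2 * ((k * a ^ (i + 1) : ℕ) : ℝ)) ^ 2 * (if i ∈ Ico M₂ M₃ then θ else 1) with hg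
  have h1 : ∏ i ∈ range r, msN t u k a n (i + 1) ≤ ∏ i ∈ range r, g i := by
    refine prod_le_prod (fun i _ => msN_nonneg _ _ _ _ _ _) fun i _ => ?_
    simp only [hg]
    split_ifs with hi
    · exact hgood i hi
    · rw [mul_one]; exact msN_le_sq t u hk ha n (i + 1)
  refine h1.trans (le_of_eq ?_)
  simp only [hg]
  rw [prod_mul_distrib, prod_ite_mem]
  have hsub : range r ∩ Ico M₂ M₃ = Ico M₂ M₃ := by
    ext i; simp only [mem_inter, mem_range, mem_Ico]; omega
  rw [hsub, prod_const, Nat.card_Ico]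


/-! ### The good factors (`2Y < m ≤ 3.5Y`): analytic core -/

/-- The majorant `θ_m = L e^{6m + mL/5 − YL}` of the ratio `msN(m)/(2ka^m)²` for the good `m`
(Ivić p. 156: `m² 2^{2m+5} N^{m/5} t^{-1} log N`). [cite: Ivic1985, p. 156] -/
def thetaM (L Y : ℝ) (m : ℕ) : ℝ := L * Real.exp (6 * m + 0.2 * m * L - Y * L)

/-- `θ* = L e^{21Y − 0.3YL} ≥ θ_m` for `m ≤ 3.5Y`. [cite: Ivic1985, p. 158] -/
def thetaStar (L Y : ℝ) : ℝ := L * Real.exp (21 * Y - 0.3 * Y * L)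

/-- `θ_m ≤ θ*` for `m ≤ 3.5 Y`. [folklore] -/
theorem thetaM_le_thetaStar {L Y : ℝ} {m : ℕ} (hL : 0 ≤ L) (hm : (m : ℝ) ≤ 3.5 * Y) :
    thetaM L Y m ≤ thetaStar L Y := by
  unfold thetaM thetaStar
  apply mul_le_mul_of_nonneg_left _ hL
  apply Real.exp_le_exp.2
  nlinarith

/-- Numeric core: `π m² ≤ 2 e^{m(6 − 4 log 2)}` (`e^{2.5m} ≥ 1 + 2.5m + 3.125m²`). [folklore] -/
theorem pi_mul_sq_le (m : ℝ) (hm : 0 ≤ m) : π * m ^ 2 ≤ 2 * Real.exp (m * (6 - 4 * Real.log 2)) := by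
  have hlog2 := Real.log_two_lt_d9
  have h1 : Real.exp (2.5 * m) ≤ Real.exp (m * (6 - 4 * Real.log 2)) := Real.exp_le_exp.2 (by nlinarith)
  have h2 := Real.quadratic_le_exp_of_nonneg (by positivity : (0:ℝ) ≤ 2.5 * m)
  have hπ := Real.pi_lt_d2
  nlinarith

/-- **The analytic core of the bound for the good factors** (Ivić p. 156: `q_m ≥ 4A_m` and
`q_m/A_m² ≤ m 2^{2m+1} N^{m/5} t^{-1}`), in abstract variables `A = k·am` (`am = a^m ∈
[(N^{2/5}/2)^m, N^{2m/5}]`), `νm = (n+u)^m ∈ [N^m, (4N)^m]`, `t = e^{YL}`, `N = e^L`, `k ≤ L/100`,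
`m > 2Y`: then `4At ≤ 2πm νm` (i.e. `1/|α_m| ≥ 4A_m`), `Aθ_m ≥ 1` and
`(2πmνm/t)(1 + log A) ≤ 2A²θ_m`. [cite: Ivic1985, p. 156] -/
theorem good_core {L Y k am νm : ℝ} {m : ℕ} (hY : 10 ≤ Y) (hL : 100 ≤ L) (hm : 2 * Y < m)
    (hk1 : 1 ≤ k) (hk : k ≤ 0.01 * L)
    (ham_lo : Real.exp (m * (0.4 * L - Real.log 2)) ≤ am) (ham_hi : am ≤ Real.exp (m * (0.4 * L)))
    (hνm_lo : Real.exp (m * L) ≤ νm) (hνm_hi : νm ≤ Real.exp (m * (L + 2 * Real.log 2))) :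
    4 * (k * am) * Real.exp (Y * L) ≤ 2 * π * m * νm ∧
    1 ≤ (k * am) * thetaM L Y m ∧
    (2 * π * m * νm / Real.exp (Y * L)) * (1 + Real.log (k * am)) ≤ 2 * (k * am) ^ 2 * thetaM L Y m := by
  set A := k * am with hAdef
  have hm20 : (20 : ℝ) ≤ m := by linarith
  have hL1 : 1 ≤ L := by linarith
  have hlog2 := Real.log_two_lt_d9
  have hlog2' := Real.log_two_gt_d9
  have hπ3 := Real.pi_gt_three
  have ham0 : 0 < am := lt_of_lt_of_le (Real.exp_pos _) ham_lo
  have hνm0 : 0 < νm := lt_of_lt_of_le (Real.exp_pos _) hνm_lo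
  have hA1 : Real.exp (m * (0.4 * L - Real.log 2)) ≤ A := by
    calc Real.exp (m * (0.4 * L - Real.log 2)) ≤ 1 * am := by rw [one_mul]; exact ham_lo
      _ ≤ k * am := mul_le_mul_of_nonneg_right hk1 ham0.le
  have hA0 : 0 < A := lt_of_lt_of_le (Real.exp_pos _) hA1
  have hkey : Y * L + 2 * L ≤ 0.6 * m * L := by nlinarith
  refine ⟨?_, ?_, ?_⟩
  · -- (i) 4 A t ≤ 2π m ν^m
    have h1 : A ≤ (0.01 * L) * Real.exp (m * (0.4 * L)) := mul_le_mul hk ham_hi ham0.le (by linarith)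
    have h4 : L ≤ Real.exp (0.6 * m * L - Y * L) := by
      have := Real.add_one_le_exp (0.6 * m * L - Y * L); linarith
    have e1 : Real.exp (m * L) = Real.exp (m * (0.4 * L)) * Real.exp (Y * L) * Real.exp (0.6 * m * L - Y * L) := by
      rw [← Real.exp_add, ← Real.exp_add]; congr 1; ring
    have hE0 : 0 < Real.exp (m * (0.4 * L)) * Real.exp (Y * L) := by positivity
    calc 4 * A * Real.exp (Y * L) ≤ 4 * ((0.01 * L) * Real.exp (m * (0.4 * L))) * Real.exp (Y * L) := by
          gcongr
      _ = (0.04 * L) * (Real.exp (m * (0.4 * L)) * Real.exp (Y * L)) := by ring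
      _ ≤ (2 * π * m * Real.exp (0.6 * m * L - Y * L)) * (Real.exp (m * (0.4 * L)) * Real.exp (Y * L)) := by
          apply mul_le_mul_of_nonneg_right _ hE0.le
          calc 0.04 * L ≤ L := by linarith
            _ ≤ Real.exp (0.6 * m * L - Y * L) := h4
            _ = 1 * Real.exp (0.6 * m * L - Y * L) := (one_mul _).symm
            _ ≤ (2 * π * m) * Real.exp (0.6 * m * L - Y * L) := by
                apply mul_le_mul_of_nonneg_right _ (Real.exp_pos _).le; nlinarith
      _ = 2 * π * m * Real.exp (m * L) := by rw [e1]; ring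
      _ ≤ 2 * π * m * νm := by gcongr
  · -- (ii) 1 ≤ A θ
    have h4 : Real.exp (m * (0.4 * L - Real.log 2)) * thetaM L Y m ≤ A * thetaM L Y m := by
      apply mul_le_mul_of_nonneg_right hA1
      unfold thetaM; positivity
    have h5 : 1 ≤ Real.exp (m * (0.4 * L - Real.log 2)) * thetaM L Y m := by
      unfold thetaM
      have e2 : Real.exp (m * (0.4 * L - Real.log 2)) * (L * Real.exp (6 * m + 0.2 * m * L - Y * L))
          = L * Real.exp (m * (0.4 * L - Real.log 2) + (6 * m + 0.2 * m * L - Y * L)) := by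
        rw [Real.exp_add]; ring
      rw [e2]
      have h3 : 1 ≤ Real.exp (m * (0.4 * L - Real.log 2) + (6 * m + 0.2 * m * L - Y * L)) :=
        Real.one_le_exp (by nlinarith)
      nlinarith
    linarith
  · -- (iii) Q (1 + log A) ≤ 2 A² θ
    have hlogA : 1 + Real.log A ≤ 0.5 * m * L := by
      have h1 : Real.log A = Real.log k + Real.log am := Real.log_mul (by linarith) ham0.ne'
      have h2 : Real.log k ≤ k - 1 := Real.log_le_sub_one_of_pos (by linarith)
      have h3 : Real.log am ≤ m * (0.4 * L) := by
        have := Real.log_le_log ham0 ham_hi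
        rwa [Real.log_exp] at this
      nlinarith
    have hlogA0 : 0 ≤ 1 + Real.log A := by
      have : 0 ≤ Real.log A := by
        apply Real.log_nonneg
        have : 1 ≤ Real.exp (m * (0.4 * L - Real.log 2)) := Real.one_le_exp (by nlinarith)
        linarith
      linarith
    set s : ℝ := m * (L + 2 * Real.log 2) - Y * L with hs
    have hQ : 2 * π * m * νm / Real.exp (Y * L) ≤ 2 * π * m * Real.exp s := by
      rw [hs, Real.exp_sub, ← mul_div_assoc]
      apply div_le_div_of_nonneg_right _ (Real.exp_pos _).le
      apply mul_le_mul_of_nonneg_left hνm_hi; positivity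
    have hQ0 : 0 ≤ 2 * π * m * νm / Real.exp (Y * L) := by positivity
    have hR : 2 * (Real.exp (m * (0.4 * L - Real.log 2))) ^ 2 * thetaM L Y m ≤ 2 * A ^ 2 * thetaM L Y m := by
      have hθ0 : 0 ≤ thetaM L Y m := by unfold thetaM; positivity
      have : (Real.exp (m * (0.4 * L - Real.log 2))) ^ 2 ≤ A ^ 2 :=
        pow_le_pow_left₀ (Real.exp_pos _).le hA1 2
      nlinarith
    have eR : 2 * (Real.exp (m * (0.4 * L - Real.log 2))) ^ 2 * thetaM L Y m =
        (2 * Real.exp (m * (6 - 4 * Real.log 2))) * (L * Real.exp s) := by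
      unfold thetaM
      rw [sq, ← Real.exp_add, hs]
      have : Real.exp (m * (0.4 * L - Real.log 2) + m * (0.4 * L - Real.log 2)) * (L * Real.exp (6 * m + 0.2 * m * L - Y * L))
          = L * Real.exp (m * (0.4 * L - Real.log 2) + m * (0.4 * L - Real.log 2) + (6 * m + 0.2 * m * L - Y * L)) := by
        rw [Real.exp_add _ (6 * m + 0.2 * m * L - Y * L)]; ring
      rw [mul_assoc 2, this]
      have : Real.exp (m * (6 - 4 * Real.log 2)) * (L * Real.exp (m * (L + 2 * Real.log 2) - Y * L)) =
          L * Real.exp (m * (6 - 4 * Real.log 2) + (m * (L + 2 * Real.log 2) - Y * L)) := by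
        rw [Real.exp_add]; ring
      rw [mul_assoc 2, this]
      congr 3; ring
    have hcore := pi_mul_sq_le (m : ℝ) (by positivity)
    calc (2 * π * m * νm / Real.exp (Y * L)) * (1 + Real.log A)
        ≤ (2 * π * m * Real.exp s) * (0.5 * m * L) := mul_le_mul hQ hlogA hlogA0 (by positivity)
      _ = (π * m ^ 2) * (L * Real.exp s) := by ring
      _ ≤ (2 * Real.exp (m * (6 - 4 * Real.log 2))) * (L * Real.exp s) := by
          apply mul_le_mul_of_nonneg_right hcore; positivity
      _ = 2 * (Real.exp (m * (0.4 * L - Real.log 2))) ^ 2 * thetaM L Y m := eR.symm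
      _ ≤ 2 * A ^ 2 * thetaM L Y m := hR


/-! ### The exponent bookkeeping -/

set_option maxHeartbeats 400000 in
/-- **The exponent bookkeeping of Ivić p. 158** (with `R = 4`, `k = 5r²`, the termwise bound on
`2Y < m ≤ 3.5Y`, and crude absolute constants): in the variables `Λ = L/Y² ≥ 10⁶`, `la = log a ≤ 2L/5`,
`4.91Y ≤ r ≤ 5.01Y`, `w = (1 − 1/r)^{4r} ≤ 0.0184`, `G = #good ∈ [1.5Y − 1, 1.5Y + 1]`, the logarithm of
`J² a^{8k²−4k} (2k)^{2r} a^{r(r+1)} θ*^G` is at most `4k²(2 la + B²/2 + 2 − 2·10⁻⁶ Λ)`. [cite: Ivic1985, p. 158] -/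
theorem numerics {B Y Λ la r w G : ℝ} (hB : 1 ≤ B) (hY : 10 ≤ Y) (hΛ : (10:ℝ) ^ 6 ≤ Λ)
    (hla0 : 0 ≤ la) (hla : la ≤ 0.4 * (Λ * Y ^ 2)) (hr1 : 4.91 * Y ≤ r) (hr2 : r ≤ 5.01 * Y)
    (hr50 : 50 ≤ r) (hw0 : 0 ≤ w) (hw : w ≤ 0.0184) (hG1 : 1.5 * Y - 1 ≤ G) (hG2 : G ≤ 1.5 * Y + 1) :
    2 * B * (5 * r ^ 2) * (4 * r + 1) * Real.log (B * r)
      + 2 * (2 * (5 * r ^ 2) - (r ^ 2 + r) / 2 + (r ^ 2 + r) / 2 * w) * la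
      + (8 * (5 * r ^ 2) ^ 2 - 4 * (5 * r ^ 2)) * la + 2 * r * Real.log (2 * (5 * r ^ 2)) + r * (r + 1) * la
      + G * (Real.log (Λ * Y ^ 2) + 21 * Y - 0.3 * Y * (Λ * Y ^ 2))
    ≤ 4 * (5 * r ^ 2) ^ 2 * (2 * la + B ^ 2 / 2 + 2 - 2e-6 * Λ) := by
  have hY0 : 0 < Y := by linarith
  have hr0 : 0 < r := by linarith
  have hΛ0 : 0 < Λ := by linarith [pow_pos (by norm_num : (0:ℝ) < 10) 6]
  have hL0 : 0 < Λ * Y ^ 2 := by positivity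
  set k : ℝ := 5 * r ^ 2 with hk
  have hk0 : 0 < k := by positivity
  have hrk : r ≤ k := by rw [hk]; nlinarith
  -- (1) the `log(Br)` term
  have h1 : 2 * B * k * (4 * r + 1) * Real.log (B * r) ≤ 2 * B ^ 2 * k ^ 2 := by
    have hBr : 0 < B * r := by positivity
    have hlog : Real.log (B * r) ≤ B * r := by linarith [Real.log_le_sub_one_of_pos hBr]
    have hlog0 : 0 ≤ Real.log (B * r) := Real.log_nonneg (by nlinarith)
    have h4r : 4 * r + 1 ≤ 5 * r := by linarith
    calc 2 * B * k * (4 * r + 1) * Real.log (B * r) ≤ 2 * B * k * (5 * r) * (B * r) := by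
          apply mul_le_mul _ hlog hlog0 (by positivity)
          apply mul_le_mul_of_nonneg_left h4r (by positivity)
      _ = 2 * B ^ 2 * k ^ 2 := by rw [hk]; ring
  -- (2) the `log(2k)` term
  have h2 : 2 * r * Real.log (2 * k) ≤ 4 * k ^ 2 := by
    have hlog : Real.log (2 * k) ≤ 2 * k := by linarith [Real.log_le_sub_one_of_pos (by positivity : 0 < 2 * k)]
    have hlog0 : 0 ≤ Real.log (2 * k) := Real.log_nonneg (by nlinarith)
    calc 2 * r * Real.log (2 * k) ≤ 2 * k * (2 * k) := by
          apply mul_le_mul _ hlog hlog0 (by positivity); linarith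
      _ = 4 * k ^ 2 := by ring
  -- (3) the defect term `(r² + r) w la`
  have hrY : 24.1 * Y ^ 2 ≤ r ^ 2 := by nlinarith
  have h3 : (r ^ 2 + r) * w * la ≤ 3.13e-4 * r ^ 4 * Λ := by
    have hrr : r ^ 2 + r ≤ 1.02 * r ^ 2 := by nlinarith
    have step1 : (r ^ 2 + r) * w * la ≤ (1.02 * r ^ 2) * 0.0184 * (0.4 * (Λ * Y ^ 2)) := by
      apply mul_le_mul _ hla hla0 (by positivity)
      exact mul_le_mul hrr hw hw0 (by positivity)
    have step2 : (1.02 * r ^ 2) * 0.0184 * (0.4 * (Λ * Y ^ 2)) ≤ 3.13e-4 * r ^ 4 * Λ := by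
      have : Y ^ 2 * 24.1 ≤ r ^ 2 := by linarith
      have hint := mul_le_mul_of_nonneg_left this (by positivity : (0:ℝ) ≤ r ^ 2 * Λ)
      have hnn : (0:ℝ) ≤ r ^ 2 * Λ * Y ^ 2 := by positivity
      nlinarith [hint, hnn]
    linarith
  -- (4) the `G` terms
  have hsqrtΛ : Real.sqrt Λ * 1000 ≤ Λ := by
    have h1000 : (1000 : ℝ) ≤ Real.sqrt Λ := by
      rw [Real.le_sqrt (by norm_num) hΛ0.le]; nlinarith
    calc Real.sqrt Λ * 1000 ≤ Real.sqrt Λ * Real.sqrt Λ := by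
          apply mul_le_mul_of_nonneg_left h1000 (Real.sqrt_nonneg _)
      _ = Λ := Real.mul_self_sqrt hΛ0.le
  have hlogL : Real.log (Λ * Y ^ 2) ≤ 0.002 * Λ * Y := by
    have hs : Real.sqrt (Λ * Y ^ 2) = Real.sqrt Λ * Y := by
      rw [Real.sqrt_mul hΛ0.le, Real.sqrt_sq hY0.le]
    have h1 : Real.log (Λ * Y ^ 2) = 2 * Real.log (Real.sqrt (Λ * Y ^ 2)) := by
      rw [Real.log_sqrt hL0.le]; ring
    have h2 : Real.log (Real.sqrt (Λ * Y ^ 2)) ≤ Real.sqrt (Λ * Y ^ 2) := by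
      have := Real.log_le_sub_one_of_pos (Real.sqrt_pos.2 hL0)
      linarith
    rw [h1, hs]
    rw [hs] at h2
    have h3 := mul_le_mul_of_nonneg_right hsqrtΛ hY0.le
    linarith
  have hlogL0 : 0 ≤ Real.log (Λ * Y ^ 2) := Real.log_nonneg (by nlinarith)
  have h4 : G * (Real.log (Λ * Y ^ 2) + 21 * Y - 0.3 * Y * (Λ * Y ^ 2)) ≤
      0.0032 * Λ * Y ^ 2 + 33.6 * Y ^ 2 - 0.42 * Λ * Y ^ 4 := by
    have hG0 : 0 ≤ G := by linarith
    have hpos : G * (Real.log (Λ * Y ^ 2) + 21 * Y) ≤ (1.6 * Y) * (0.002 * Λ * Y + 21 * Y) := by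
      apply mul_le_mul (by linarith) (by linarith) (by positivity) (by positivity)
    have hneg : (1.4 * Y) * (0.3 * Y * (Λ * Y ^ 2)) ≤ G * (0.3 * Y * (Λ * Y ^ 2)) := by
      apply mul_le_mul_of_nonneg_right (by linarith) (by positivity)
    have e : G * (Real.log (Λ * Y ^ 2) + 21 * Y - 0.3 * Y * (Λ * Y ^ 2)) =
        G * (Real.log (Λ * Y ^ 2) + 21 * Y) - G * (0.3 * Y * (Λ * Y ^ 2)) := by ring
    rw [e]
    linarith
  -- (5) convert `Y`-powers into `r`-powers
  have hY4 : r ^ 4 ≤ 630.02 * Y ^ 4 := by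
    have : r ^ 2 ≤ 25.1001 * Y ^ 2 := by nlinarith
    nlinarith
  have h5a : -(0.42 * Λ * Y ^ 4) ≤ -(6.666e-4 * r ^ 4 * Λ) := by
    have := mul_le_mul_of_nonneg_left hY4 hΛ0.le
    have hnn : 0 ≤ Λ * Y ^ 4 := by positivity
    linarith
  have hr2' : 2500 ≤ r ^ 2 := by nlinarith
  have hrr4 : r ^ 2 * 2500 ≤ r ^ 2 * r ^ 2 := mul_le_mul_of_nonneg_left hr2' (by positivity)
  have h5b : 0.0032 * Λ * Y ^ 2 ≤ 5.4e-8 * Λ * r ^ 4 := by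
    have ha := mul_le_mul_of_nonneg_left hrY hΛ0.le
    have hb := mul_le_mul_of_nonneg_left hrr4 hΛ0.le
    have e4 : r ^ 4 = r ^ 2 * r ^ 2 := by ring
    rw [e4]
    linarith
  have h5c : 33.6 * Y ^ 2 ≤ 6e-4 * r ^ 4 := by
    have e4 : r ^ 4 = r ^ 2 * r ^ 2 := by ring
    rw [e4]
    linarith
  -- assemble
  have eL : 2 * (2 * k - (r ^ 2 + r) / 2 + (r ^ 2 + r) / 2 * w) * la + (8 * k ^ 2 - 4 * k) * la + r * (r + 1) * la
      = 8 * k ^ 2 * la + (r ^ 2 + r) * w * la := by ring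
  have hk2 : k ^ 2 = 25 * r ^ 4 := by rw [hk]; ring
  have hk2Λ : k ^ 2 * Λ = 25 * r ^ 4 * Λ := by rw [hk2]
  have hk2la : k ^ 2 * la = 25 * r ^ 4 * la := by rw [hk2]
  have hk2B : B ^ 2 * k ^ 2 = 25 * (B ^ 2 * r ^ 4) := by rw [hk2]; ring
  linarith [h1, h2, h3, h4, h5a, h5b, h5c, hk2, hk2Λ, hk2la, hk2B]


/-! ### The good factors: `msN(m) ≤ (2ka^m)² θ_m` for `m > 2Y` -/

/-- `|α_m| = t/(2πm(n+u)^m)` (`t ≥ 0`). [cite: Ivic1985, (6.40)] -/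
theorem abs_αN {t u : ℝ} (ht : 0 ≤ t) {n : ℕ} (hν : 0 < (n : ℝ) + u) (m : ℕ) :
    |αN t u n m| = t / (2 * π * m * ((n : ℝ) + u) ^ m) := by
  unfold αN
  rw [abs_div, abs_mul, abs_of_nonneg ht, abs_pow, abs_neg, abs_one, one_pow, mul_one]
  congr 1
  have : 0 ≤ 2 * π * m * ((n : ℝ) + u) ^ m := by positivity
  rw [abs_of_nonneg this]

/-- **The good factors** (Ivić p. 156): for `m > 2Y` (and `k ≤ L/100`, `N^{2/5}/2 ≤ a ≤ N^{2/5}`,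
`N ≤ n + u ≤ 4N`, `t = N^Y`, `N = e^L`, `L ≥ 100`, `Y ≥ 10`) one has `1/|α_m| ≥ 4ka^m`, so that by the
used case of Lemma 6.5 `∑_{|μ|<ka^m} min(2ka^m, 1/(2‖α_mμ‖)) ≤ 2A + |α_m|⁻¹(1 + log A) ≤ (2A)²θ_m`,
`A = ka^m`. [cite: Ivic1985, p. 156] -/
theorem msN_le_good {t u L Y : ℝ} {k a n m : ℕ} (hY : 10 ≤ Y) (hL : 100 ≤ L)
    (ht : t = Real.exp (Y * L)) (hk1 : 1 ≤ k) (hk : (k : ℝ) ≤ 0.01 * L)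
    (halo : Real.exp (0.4 * L - Real.log 2) ≤ a) (hahi : (a : ℝ) ≤ Real.exp (0.4 * L))
    (hνlo : Real.exp L ≤ (n : ℝ) + u) (hνhi : (n : ℝ) + u ≤ Real.exp (L + 2 * Real.log 2))
    (hm : 2 * Y < m) :
    msN t u k a n m ≤ (2 * ((k * a ^ m : ℕ) : ℝ)) ^ 2 * thetaM L Y m := by
  have ha0 : (0 : ℝ) < a := lt_of_lt_of_le (Real.exp_pos _) halo
  have ha1 : 1 ≤ a := Nat.one_le_iff_ne_zero.2 (by rintro rfl; simp at ha0)
  have hν0 : 0 < (n : ℝ) + u := lt_of_lt_of_le (Real.exp_pos _) hνlo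
  have ht0 : 0 < t := by rw [ht]; exact Real.exp_pos _
  have hm0 : (0 : ℝ) < m := by linarith
  -- powers
  have ham_lo : Real.exp (m * (0.4 * L - Real.log 2)) ≤ (a : ℝ) ^ m := by
    rw [Real.exp_nat_mul]; exact pow_le_pow_left₀ (Real.exp_pos _).le halo m
  have ham_hi : (a : ℝ) ^ m ≤ Real.exp (m * (0.4 * L)) := by
    rw [Real.exp_nat_mul]; exact pow_le_pow_left₀ ha0.le hahi m
  have hνm_lo : Real.exp (m * L) ≤ ((n : ℝ) + u) ^ m := by
    rw [Real.exp_nat_mul]; exact pow_le_pow_left₀ (Real.exp_pos _).le hνlo m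
  have hνm_hi : ((n : ℝ) + u) ^ m ≤ Real.exp (m * (L + 2 * Real.log 2)) := by
    rw [Real.exp_nat_mul]; exact pow_le_pow_left₀ hν0.le hνhi m
  obtain ⟨h4', hI, hII⟩ := good_core hY hL hm (Nat.one_le_cast.2 hk1) hk ham_lo ham_hi hνm_lo hνm_hi
  -- the hypotheses of the used case of Lemma 6.5
  have hA1 : 1 ≤ k * a ^ m := Nat.one_le_iff_ne_zero.2 (Nat.mul_ne_zero (Nat.one_le_iff_ne_zero.1 hk1)
    (pow_ne_zero _ (Nat.one_le_iff_ne_zero.1 ha1)))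
  have hAcast : ((k * a ^ m : ℕ) : ℝ) = (k : ℝ) * (a : ℝ) ^ m := by push_cast; ring
  have hden : 0 < 2 * π * m * ((n : ℝ) + u) ^ m := by positivity
  have hαabs : |αN t u n m| = t / (2 * π * m * ((n : ℝ) + u) ^ m) := abs_αN ht0.le hν0 m
  have hα : αN t u n m ≠ 0 := by
    intro h; rw [h, abs_zero] at hαabs; exact (div_pos ht0 hden).ne' hαabs.symm
  have h4 : 4 * ((k * a ^ m : ℕ) : ℝ) * |αN t u n m| ≤ 1 := by
    rw [hαabs, hAcast, ← mul_div_assoc, div_le_one hden, ht]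
    exact h4'
  have hmain := sum_geomBound_le_of_small hα hA1 h4
  unfold msN
  refine hmain.trans ?_
  rw [hαabs, one_div_div, hAcast, ht]
  have hA0 : 0 ≤ (k : ℝ) * (a : ℝ) ^ m := by positivity
  nlinarith [hI, hII, hA0]

/-! ### Assembly for one `n`: `|U(n)| ≤ a² e^{B²/2+2} e^{−2·10⁻⁶ L/Y²}` -/

/-- `(1 − 1/r)^{4r} ≤ e^{-4} ≤ 0.0184` (`r ≥ 1`). [folklore] -/
theorem one_sub_inv_pow_le {r : ℕ} (hr : 1 ≤ r) : (1 - 1 / (r : ℝ)) ^ (4 * r) ≤ 0.0184 := by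
  have h1 : (1 - 1 / (r : ℝ)) ^ r ≤ Real.exp (-1) :=
    Real.one_sub_div_pow_le_exp_neg (by exact_mod_cast hr)
  have h0 : 0 ≤ 1 - 1 / (r : ℝ) := by
    rw [sub_nonneg, div_le_one (by exact_mod_cast (by omega : 0 < r))]; exact_mod_cast hr
  have h2 : (1 - 1 / (r : ℝ)) ^ (4 * r) ≤ Real.exp (-1) ^ 4 := by
    rw [mul_comm, pow_mul]; exact pow_le_pow_left₀ (pow_nonneg h0 _) h1 4
  have h3 : Real.exp (-1) ^ 4 ≤ 0.0184 := by
    rw [Real.exp_neg, inv_pow]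
    have he := Real.exp_one_gt_d9
    have h4 : (2.7182818283 : ℝ) ^ 4 ≤ Real.exp 1 ^ 4 := pow_le_pow_left₀ (by norm_num) he.le 4
    rw [inv_le_comm₀ (by positivity) (by norm_num)]
    refine le_trans ?_ h4
    norm_num
  exact h2.trans h3

/-- `∑_{i<r} log((2ka^{i+1})²) = 2r log(2k) + r(r+1) log a`. [folklore] -/
theorem sum_log_sq (k a r : ℕ) (hk : 0 < (k : ℝ)) (ha : 0 < (a : ℝ)) :
    ∑ i ∈ range r, Real.log ((2 * ((k * a ^ (i + 1) : ℕ) : ℝ)) ^ 2) =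
      2 * r * Real.log (2 * k) + r * (r + 1) * Real.log a := by
  have h : ∀ i ∈ range r, Real.log ((2 * ((k * a ^ (i + 1) : ℕ) : ℝ)) ^ 2) =
      2 * Real.log (2 * k) + (2 * ((i : ℝ) + 1)) * Real.log a := by
    intro i _
    push_cast
    rw [Real.log_pow, show (2 : ℝ) * (k * (a : ℝ) ^ (i + 1)) = (2 * k) * (a : ℝ) ^ (i + 1) by ring,
      Real.log_mul (by positivity) (by positivity), Real.log_pow]
    push_cast; ring
  rw [sum_congr rfl h, sum_add_distrib, sum_const, card_range, ← sum_mul, sum_range_two_mul_succ]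
  simp only [nsmul_eq_mul]
  ring

set_option maxHeartbeats 800000 in
/-- **`|U(n)| ≤ a² e^{B²/2+2} exp(−2·10⁻⁶ L/Y²)`** for every `n` with `N ≤ n + u ≤ 4N` (Ivić pp. 156–159:
Korobov's bound, the factor bounds, the mean value bound `hJ` for `J_{k,r}(a)` — the instance degree `r`,
`4r` iterations, `k = 5r² = r² + r·4r`, `P = a` of Ivić's Lemma 6.3 (`VMV.lemma63_five_sq`) / `VMVTBound B` — and the bookkeeping
`numerics`), in the main range `L ≥ 10⁶ Y²`.
[cite: Ivic1985, Theorem 6.2, (6.44)–(6.46)] -/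
theorem norm_Usum_le {B : ℝ} (hB : 1 ≤ B) {t u L Y : ℝ}
    {a n r k M₂ M₃ : ℕ} (hY : 10 ≤ Y) (hL : (10 : ℝ) ^ 6 * Y ^ 2 ≤ L) (ht : t = Real.exp (Y * L))
    (hr1 : 4.91 * Y ≤ r) (hr2 : (r : ℝ) ≤ 5.01 * Y) (hr50 : 50 ≤ r) (hk : k = 5 * r ^ 2)
    (halo : Real.exp (0.4 * L - Real.log 2) ≤ a) (hahi : (a : ℝ) ≤ Real.exp (0.4 * L))
    (hνlo : Real.exp L ≤ (n : ℝ) + u) (hνhi : (n : ℝ) + u ≤ Real.exp (L + 2 * Real.log 2))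
    (hM : M₃ ≤ r) (hgood : ∀ i ∈ Ico M₂ M₃, 2 * Y < (i + 1 : ℕ) ∧ ((i + 1 : ℕ) : ℝ) ≤ 3.5 * Y)
    (hG1 : 1.5 * Y - 1 ≤ ((M₃ - M₂ : ℕ) : ℝ)) (hG2 : ((M₃ - M₂ : ℕ) : ℝ) ≤ 1.5 * Y + 1)
    (hJ : (J r k (Icc (1 : ℤ) a) : ℝ) ≤ (B * r) ^ (B * k * (((4 * r : ℕ) : ℝ) + 1)) *
      (a : ℝ) ^ ((2 * k : ℝ) - ((r : ℝ) ^ 2 + r) / 2 + ((r : ℝ) ^ 2 + r) / 2 * (1 - 1 / (r : ℝ)) ^ (4 * r))) :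
    ‖Usum a (αv t u r n)‖ ≤ (a : ℝ) ^ 2 * Real.exp (B ^ 2 / 2 + 2) * Real.exp (-(2e-6 * L / Y ^ 2)) := by
  -- basic facts
  have hY0 : 0 < Y := by linarith
  have hY2 : 100 ≤ Y ^ 2 := by nlinarith
  have hL100 : 100 ≤ L := by nlinarith
  have hL0 : 0 < L := by linarith
  have ha0 : (0 : ℝ) < a := lt_of_lt_of_le (Real.exp_pos _) halo
  have ha1 : 1 ≤ a := Nat.one_le_iff_ne_zero.2 (by rintro rfl; simp at ha0)
  have hr1' : 1 ≤ r := by omega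
  have hr2' : 2 ≤ r := by omega
  have hrR : (50 : ℝ) ≤ r := by exact_mod_cast hr50
  have hk1 : 1 ≤ k := by rw [hk]; nlinarith
  have hkR : (k : ℝ) = 5 * (r : ℝ) ^ 2 := by rw [hk]; push_cast; ring
  have hk0 : (0 : ℝ) < k := by rw [hkR]; positivity
  have hk01 : (k : ℝ) ≤ 0.01 * L := by rw [hkR]; nlinarith
  set la := Real.log a with hla_def
  have hla0 : 0 ≤ la := Real.log_nonneg (by exact_mod_cast ha1)
  have hla : la ≤ 0.4 * L := by
    have := Real.log_le_log ha0 hahi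
    rw [Real.log_exp] at this; linarith
  -- the product of the factors
  set θs := thetaStar L Y with hθs
  have hθs0 : 0 < θs := by rw [hθs]; unfold thetaStar; positivity
  set Psq := ∏ i ∈ range r, (2 * ((k * a ^ (i + 1) : ℕ) : ℝ)) ^ 2 with hPsq
  have hPsq0 : 0 < Psq := by rw [hPsq]; exact prod_pos fun i _ => by positivity
  have hprod : ∏ j, mnSum k a (αv t u r n) j ≤ Psq * θs ^ (M₃ - M₂) := by
    rw [prod_mnSum_eq]
    refine prod_msN_le hk1 ha1 hM fun i hi => ?_
    obtain ⟨h1, h2⟩ := hgood i hi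
    calc msN t u k a n (i + 1) ≤ (2 * ((k * a ^ (i + 1) : ℕ) : ℝ)) ^ 2 * thetaM L Y (i + 1) :=
          msN_le_good hY hL100 ht hk1 hk01 halo hahi hνlo hνhi h1
      _ ≤ (2 * ((k * a ^ (i + 1) : ℕ) : ℝ)) ^ 2 * θs :=
          mul_le_mul_of_nonneg_left (thetaM_le_thetaStar hL0.le h2) (sq_nonneg _)
  -- Korobov's bound and the mean value bound
  have hX := norm_Usum_pow_le ha1 hk1 (αv t u r n)
  set w := (1 - 1 / (r : ℝ)) ^ (4 * r) with hw_def
  have hw0 : 0 ≤ w := by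
    rw [hw_def]; apply pow_nonneg
    rw [sub_nonneg, div_le_one (by positivity)]; linarith
  have hw : w ≤ 0.0184 := one_sub_inv_pow_le hr1'
  set eJ : ℝ := (2 * k : ℝ) - ((r : ℝ) ^ 2 + r) / 2 + ((r : ℝ) ^ 2 + r) / 2 * w with heJ
  set e₁ : ℝ := B * k * (((4 * r : ℕ) : ℝ) + 1) with he₁
  set JB : ℝ := (B * r) ^ e₁ * (a : ℝ) ^ eJ with hJB
  have hBr : 0 < B * r := by positivity
  have hJB0 : 0 < JB := by rw [hJB]; exact mul_pos (Real.rpow_pos_of_pos hBr _) (Real.rpow_pos_of_pos ha0 _)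
  have hJ' : (J r k (Icc (1 : ℤ) a) : ℝ) ≤ JB := by
    rw [hJB, he₁, heJ, hw_def]
    convert hJ using 2
  have hJ0 : (0 : ℝ) ≤ J r k (Icc (1 : ℤ) a) := by positivity
  set X' : ℝ := JB ^ 2 * (a : ℝ) ^ (8 * k ^ 2 - 4 * k) * (Psq * θs ^ (M₃ - M₂)) with hX'
  have hXX : ‖Usum a (αv t u r n)‖ ^ (4 * k ^ 2) ≤ X' := by
    refine hX.trans ?_
    rw [hX']
    apply mul_le_mul _ hprod (prod_nonneg fun j _ => mnSum_nonneg _ _ _ _) (by positivity)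
    exact mul_le_mul_of_nonneg_right (pow_le_pow_left₀ hJ0 hJ' 2) (by positivity)
  -- the case `U = 0`
  rcases eq_or_lt_of_le (norm_nonneg (Usum a (αv t u r n))) with h0 | hUpos
  · rw [← h0]; positivity
  -- logarithms
  have hX'0 : 0 < X' := by rw [hX']; positivity
  have hlogle : ((4 * k ^ 2 : ℕ) : ℝ) * Real.log ‖Usum a (αv t u r n)‖ ≤ Real.log X' := by
    rw [← Real.log_pow]; exact Real.log_le_log (pow_pos hUpos _) hXX
  have hlogX' : Real.log X' = 2 * (e₁ * Real.log (B * r) + eJ * la) + ((8 * k ^ 2 - 4 * k : ℕ) : ℝ) * la +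
      (2 * r * Real.log (2 * k) + r * (r + 1) * la) + (M₃ - M₂ : ℕ) * (Real.log L + (21 * Y - 0.3 * Y * L)) := by
    rw [hX']
    have hne1 : JB ^ 2 ≠ 0 := by positivity
    have hne2 : (a : ℝ) ^ (8 * k ^ 2 - 4 * k) ≠ 0 := by positivity
    have hne3 : Psq ≠ 0 := hPsq0.ne'
    have hne4 : θs ^ (M₃ - M₂) ≠ 0 := by positivity
    rw [Real.log_mul (mul_ne_zero hne1 hne2) (mul_ne_zero hne3 hne4), Real.log_mul hne1 hne2,
      Real.log_mul hne3 hne4, Real.log_pow, Real.log_pow, Real.log_pow]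
    have hlJB : Real.log JB = e₁ * Real.log (B * r) + eJ * la := by
      rw [hJB, Real.log_mul (Real.rpow_pos_of_pos hBr _).ne' (Real.rpow_pos_of_pos ha0 _).ne',
        Real.log_rpow hBr, Real.log_rpow ha0]
    have hlP : Real.log Psq = 2 * r * Real.log (2 * k) + r * (r + 1) * la := by
      rw [hPsq, Real.log_prod fun i _ => by positivity]
      exact sum_log_sq k a r hk0 ha0
    have hlθ : Real.log θs = Real.log L + (21 * Y - 0.3 * Y * L) := by
      rw [hθs]; unfold thetaStar
      rw [Real.log_mul hL0.ne' (Real.exp_pos _).ne', Real.log_exp]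
    rw [hlJB, hlP, hlθ]
    push_cast
    ring
  -- the bookkeeping
  have hcast1 : ((8 * k ^ 2 - 4 * k : ℕ) : ℝ) = 8 * (k : ℝ) ^ 2 - 4 * k := by
    have : 4 * k ≤ 8 * k ^ 2 := by nlinarith
    push_cast [Nat.cast_sub this]; ring
  have hcast2 : ((4 * k ^ 2 : ℕ) : ℝ) = 4 * (k : ℝ) ^ 2 := by push_cast; ring
  set Λ := L / Y ^ 2 with hΛdef
  have hΛL : Λ * Y ^ 2 = L := by rw [hΛdef]; field_simp
  have hΛ : (10 : ℝ) ^ 6 ≤ Λ := by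
    rw [hΛdef, le_div_iff₀ (by positivity)]; linarith
  have hnum := numerics (B := B) (Y := Y) (Λ := Λ) (la := la) (r := r) (w := w) (G := ((M₃ - M₂ : ℕ) : ℝ))
    hB hY hΛ hla0 (by rw [hΛL]; exact hla) hr1 hr2 hrR hw0 hw hG1 hG2
  rw [hΛL] at hnum
  have hmain : 4 * (k : ℝ) ^ 2 * Real.log ‖Usum a (αv t u r n)‖ ≤
      4 * (k : ℝ) ^ 2 * (2 * la + B ^ 2 / 2 + 2 - 2e-6 * Λ) := by
    rw [hcast2] at hlogle
    rw [hlogX', hcast1] at hlogle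
    refine hlogle.trans ?_
    have e4r : (((4 * r : ℕ) : ℝ) + 1) = 4 * (r : ℝ) + 1 := by push_cast; ring
    rw [he₁, heJ, e4r, hkR]
    nlinarith [hnum]
  have hlogU : Real.log ‖Usum a (αv t u r n)‖ ≤ 2 * la + B ^ 2 / 2 + 2 - 2e-6 * Λ :=
    le_of_mul_le_mul_left hmain (by positivity)
  calc ‖Usum a (αv t u r n)‖ = Real.exp (Real.log ‖Usum a (αv t u r n)‖) := (Real.exp_log hUpos).symm
    _ ≤ Real.exp (2 * la + B ^ 2 / 2 + 2 - 2e-6 * Λ) := Real.exp_le_exp.2 hlogU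
    _ = (a : ℝ) ^ 2 * Real.exp (B ^ 2 / 2 + 2) * Real.exp (-(2e-6 * L / Y ^ 2)) := by
        rw [show 2 * la + B ^ 2 / 2 + 2 - 2e-6 * Λ = 2 * la + (B ^ 2 / 2 + 2) + (-(2e-6 * L / Y ^ 2)) by
          rw [hΛdef]; ring, Real.exp_add, Real.exp_add]
        congr 2
        rw [hla_def, show (2 : ℝ) * Real.log (a : ℝ) = Real.log ((a : ℝ) ^ 2) by
          rw [Real.log_pow]; norm_num, Real.exp_log (by positivity)]

/-! ### The estimate of the zeta sum in the main range -/

/-- Floors: `x − 1 < ⌊x⌋₊ ≤ x` for `x ≥ 0`. [folklore] -/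
theorem floor_bounds {x : ℝ} (hx : 0 ≤ x) : x - 1 < (⌊x⌋₊ : ℝ) ∧ (⌊x⌋₊ : ℝ) ≤ x :=
  ⟨by have := Nat.lt_floor_add_one x; linarith, Nat.floor_le hx⟩

/-- The Taylor error: `2t z^{r+1} ≤ 2 exp(−2·10⁻⁶ L/Y²)` for `z ≤ e^{−L/5}`, `t = e^{YL}`, `r + 1 > 5.01Y`
(Ivić: `Nt(a²n⁻¹)^{r+1} ≤ Nt^{-1/500}`). [cite: Ivic1985, (6.38)–(6.39)] -/
theorem taylor_err_le {t L Y z : ℝ} {r : ℕ} (hY : 10 ≤ Y) (hL : 0 < L) (ht : t = Real.exp (Y * L))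
    (hz0 : 0 ≤ z) (hz : z ≤ Real.exp (-(0.2 * L))) (hr : 5.01 * Y < (r : ℝ) + 1) :
    2 * t * z ^ (r + 1) ≤ 2 * Real.exp (-(2e-6 * L / Y ^ 2)) := by
  have hY0 : 0 < Y := by linarith
  have h1 : z ^ (r + 1) ≤ Real.exp (-(0.2 * L)) ^ (r + 1) := pow_le_pow_left₀ hz0 hz (r + 1)
  rw [← Real.exp_nat_mul] at h1
  have h2 : t * z ^ (r + 1) ≤ Real.exp (Y * L + ((r + 1 : ℕ) : ℝ) * -(0.2 * L)) := by
    rw [Real.exp_add, ht]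
    exact mul_le_mul_of_nonneg_left h1 (Real.exp_pos _).le
  have h3 : Y * L + ((r + 1 : ℕ) : ℝ) * -(0.2 * L) ≤ -(2e-6 * L / Y ^ 2) := by
    push_cast
    have h5 : 5.01 * Y * (0.2 * L) ≤ ((r : ℝ) + 1) * (0.2 * L) :=
      mul_le_mul_of_nonneg_right hr.le (by positivity)
    have hY3 : 1000 ≤ Y * Y ^ 2 := by nlinarith
    have h6 : 2e-6 * L / Y ^ 2 ≤ 0.002 * Y * L := by
      rw [div_le_iff₀ (by positivity)]
      nlinarith [mul_le_mul_of_nonneg_left hY3 (by positivity : (0 : ℝ) ≤ 0.002 * L)]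
    nlinarith
  have h4 := Real.exp_le_exp.2 h3
  linarith [h2.trans h4]

set_option maxHeartbeats 400000 in
/-- **Ivić's Theorem 6.2 for the shifted zeta sums, main range** (`N ≥ 2`, `t ≥ N^{21/2}`,
`log N ≥ 10⁶ (log t/log N)²`): `‖∑_{N<n≤R} (n+u)^{-it}‖ ≤ (e^{B²/2+2} + 4) N exp(−2·10⁻⁶ log³N/log²t)`,
from the mean value bound `hJ` at the parameters used (an instance of `VMV.lemma63_five_sq` / `VMVTBound B`):
Vinogradov's shift `VinogradovZetaSum.norm_zetaSum_le_shift` with `a = [N^{2/5}]`, `r = [5.01 log t/log N]`, then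
`norm_Usum_le` (`k = 5r²`) for each `n` and `taylor_err_le` (Ivić (6.36)–(6.46)). [cite: Ivic1985, Theorem 6.2] -/
theorem norm_zetaSum_le_main {B : ℝ} (hB : 1 ≤ B) {N R : ℕ} {t u : ℝ}
    (hN : 2 ≤ N) (hNt : (N : ℝ) ^ ((10 : ℝ) + 1 / 2) ≤ t) (hu0 : 0 < u) (hu1 : u ≤ 1)
    (hNR : N < R) (hR : R ≤ 2 * N)
    (hmain : (10 : ℝ) ^ 6 * (Real.log t / Real.log N) ^ 2 ≤ Real.log N)
    (hJ : ∀ r k a : ℕ, 50 ≤ r → (r : ℝ) ≤ 5.01 * (Real.log t / Real.log N) → k = 5 * r ^ 2 →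
      Real.exp (0.4 * Real.log N - Real.log 2) ≤ a →
      (J r k (Icc (1 : ℤ) a) : ℝ) ≤ (B * r) ^ (B * k * (((4 * r : ℕ) : ℝ) + 1)) *
        (a : ℝ) ^ ((2 * k : ℝ) - ((r : ℝ) ^ 2 + r) / 2 + ((r : ℝ) ^ 2 + r) / 2 * (1 - 1 / (r : ℝ)) ^ (4 * r))) :
    ‖∑ n ∈ Ioc N R, ((n : ℂ) + u) ^ (-(t * I))‖ ≤ (Real.exp (B ^ 2 / 2 + 2) + 4) * N *
      Real.exp (-(2e-6 * Real.log N / (Real.log t / Real.log N) ^ 2)) := by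
  -- the parameters `L`, `Y`
  have hN0 : (0 : ℝ) < N := by exact_mod_cast (by omega : 0 < N)
  have hN2 : (2 : ℝ) ≤ N := by exact_mod_cast hN
  obtain ⟨L, hLdef⟩ : ∃ L : ℝ, L = Real.log N := ⟨_, rfl⟩
  obtain ⟨Y, hYdef⟩ : ∃ Y : ℝ, Y = Real.log t / L := ⟨_, rfl⟩
  rw [← hLdef, ← hYdef] at hmain hJ ⊢
  have hL0 : 0 < L := by rw [hLdef]; exact Real.log_pos (by linarith)
  have hNexp : (N : ℝ) = Real.exp L := by rw [hLdef, Real.exp_log hN0]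
  have ht0 : 0 < t := lt_of_lt_of_le (Real.rpow_pos_of_pos hN0 _) hNt
  have hlogt : Real.log t = Y * L := by rw [hYdef]; field_simp
  have ht : t = Real.exp (Y * L) := by rw [← hlogt, Real.exp_log ht0]
  have hY : 10 ≤ Y := by
    have h1 := Real.log_le_log (Real.rpow_pos_of_pos hN0 _) hNt
    rw [Real.log_rpow hN0, ← hLdef, hlogt] at h1
    nlinarith
  have hY0 : 0 < Y := by linarith
  have hL : (10 : ℝ) ^ 6 * Y ^ 2 ≤ L := hmain
  have hL8 : (10 : ℝ) ^ 8 ≤ L := by nlinarith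
  have hlog2 := Real.log_two_lt_d9
  -- `r`, `k`
  obtain ⟨r, hrdef⟩ : ∃ r : ℕ, r = ⌊5.01 * Y⌋₊ := ⟨_, rfl⟩
  obtain ⟨hrlo, hr2⟩ := floor_bounds (by positivity : (0 : ℝ) ≤ 5.01 * Y)
  rw [← hrdef] at hrlo hr2
  have hr1 : 4.91 * Y ≤ r := by linarith
  have hr50 : 50 ≤ r := by
    by_contra h
    have : (r : ℝ) ≤ 49 := by exact_mod_cast (by omega : r ≤ 49)
    linarith
  -- `a`
  obtain ⟨a, hadef⟩ : ∃ a : ℕ, a = ⌊Real.exp (0.4 * L)⌋₊ := ⟨_, rfl⟩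
  obtain ⟨halo', hahi⟩ := floor_bounds (Real.exp_pos (0.4 * L)).le
  rw [← hadef] at halo' hahi
  have h2e : (2 : ℝ) ≤ Real.exp (0.2 * L) := by
    calc (2 : ℝ) = Real.exp (Real.log 2) := (Real.exp_log two_pos).symm
      _ ≤ Real.exp (0.2 * L) := Real.exp_le_exp.2 (by linarith)
  have h2e' : (2 : ℝ) ≤ Real.exp (0.4 * L) := h2e.trans (Real.exp_le_exp.2 (by linarith))
  have halo : Real.exp (0.4 * L - Real.log 2) ≤ a := by
    rw [Real.exp_sub, Real.exp_log two_pos]; linarith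
  have ha0 : (0 : ℝ) < a := lt_of_lt_of_le (by positivity) halo
  have ha1 : 1 ≤ a := Nat.one_le_iff_ne_zero.2 (by rintro rfl; simp at ha0)
  have ha2 : (a : ℝ) ^ 2 ≤ (N : ℝ) * Real.exp (-(0.2 * L)) := by
    calc (a : ℝ) ^ 2 ≤ Real.exp (0.4 * L) ^ 2 := pow_le_pow_left₀ ha0.le hahi 2
      _ = Real.exp L * Real.exp (-(0.2 * L)) := by rw [sq, ← Real.exp_add, ← Real.exp_add]; ring_nf
      _ = (N : ℝ) * Real.exp (-(0.2 * L)) := by rw [hNexp]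
  have haN : 2 * a ^ 2 ≤ N := by
    have h1 : 2 * (a : ℝ) ^ 2 ≤ N := by
      calc 2 * (a : ℝ) ^ 2 ≤ 2 * ((N : ℝ) * Real.exp (-(0.2 * L))) := by linarith
        _ = (N : ℝ) * (2 * (Real.exp (0.2 * L))⁻¹) := by rw [Real.exp_neg]; ring
        _ ≤ (N : ℝ) * 1 := by
            apply mul_le_mul_of_nonneg_left _ hN0.le
            rw [mul_inv_le_iff₀ (Real.exp_pos _), one_mul]; exact h2e
        _ = N := mul_one _
    exact_mod_cast h1
  have hs : Real.exp (-(0.2 * L)) ≤ Real.exp (-(2e-6 * L / Y ^ 2)) := by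
    apply Real.exp_le_exp.2
    have hY2 : 1 ≤ Y ^ 2 := by nlinarith
    have : 2e-6 * L / Y ^ 2 ≤ 0.2 * L := by
      rw [div_le_iff₀ (by positivity)]
      nlinarith [mul_le_mul_of_nonneg_left hY2 (by positivity : (0 : ℝ) ≤ 0.2 * L)]
    linarith
  have hz : (a : ℝ) ^ 2 / N ≤ Real.exp (-(0.2 * L)) := by
    rw [div_le_iff₀ hN0]; linarith
  have hrlo' : 5.01 * Y < (r : ℝ) + 1 := by linarith
  have herr := taylor_err_le hY hL0 ht (by positivity : (0 : ℝ) ≤ (a : ℝ) ^ 2 / N) hz hrlo'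
  have ha2s : (a : ℝ) ^ 2 ≤ (N : ℝ) * Real.exp (-(2e-6 * L / Y ^ 2)) :=
    ha2.trans (mul_le_mul_of_nonneg_left hs hN0.le)
  -- `M₂`, `M₃`
  obtain ⟨M₂, hM₂def⟩ : ∃ M : ℕ, M = ⌊2 * Y⌋₊ := ⟨_, rfl⟩
  obtain ⟨M₃, hM₃def⟩ : ∃ M : ℕ, M = ⌊3.5 * Y⌋₊ := ⟨_, rfl⟩
  obtain ⟨hM₂lo, hM₂hi⟩ := floor_bounds (by positivity : (0 : ℝ) ≤ 2 * Y)
  obtain ⟨hM₃lo, hM₃hi⟩ := floor_bounds (by positivity : (0 : ℝ) ≤ 3.5 * Y)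
  rw [← hM₂def] at hM₂lo hM₂hi
  rw [← hM₃def] at hM₃lo hM₃hi
  have hM23 : M₂ ≤ M₃ := by rw [hM₂def, hM₃def]; exact Nat.floor_le_floor (by linarith)
  have hM : M₃ ≤ r := by rw [hrdef, hM₃def]; exact Nat.floor_le_floor (by linarith)
  have hGcast : ((M₃ - M₂ : ℕ) : ℝ) = (M₃ : ℝ) - M₂ := by push_cast [Nat.cast_sub hM23]; ring
  have hG1 : 1.5 * Y - 1 ≤ ((M₃ - M₂ : ℕ) : ℝ) := by rw [hGcast]; linarith
  have hG2 : ((M₃ - M₂ : ℕ) : ℝ) ≤ 1.5 * Y + 1 := by rw [hGcast]; linarith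
  have hgood : ∀ i ∈ Ico M₂ M₃, 2 * Y < (i + 1 : ℕ) ∧ ((i + 1 : ℕ) : ℝ) ≤ 3.5 * Y := by
    intro i hi
    obtain ⟨hi1, hi2⟩ := mem_Ico.1 hi
    have hi1' : (M₂ : ℝ) ≤ i := by exact_mod_cast hi1
    have hi2' : (i : ℝ) + 1 ≤ M₃ := by exact_mod_cast hi2
    push_cast
    constructor <;> linarith
  -- each `n`
  have hU : ∀ n ∈ Ioc N R, ‖Usum a (αv t u r n)‖ ≤
      (a : ℝ) ^ 2 * Real.exp (B ^ 2 / 2 + 2) * Real.exp (-(2e-6 * L / Y ^ 2)) := by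
    intro n hn
    obtain ⟨hn1, hn2⟩ := mem_Ioc.1 hn
    have hn1' : (N : ℝ) + 1 ≤ n := by exact_mod_cast hn1
    have hn2' : (n : ℝ) ≤ 2 * N := by exact_mod_cast (hn2.trans hR)
    have hνlo : Real.exp L ≤ (n : ℝ) + u := by rw [← hNexp]; linarith
    have hνhi : (n : ℝ) + u ≤ Real.exp (L + 2 * Real.log 2) := by
      have e4 : Real.exp (L + 2 * Real.log 2) = 4 * N := by
        rw [Real.exp_add, ← hNexp, show (2 : ℝ) * Real.log 2 = Real.log (2 ^ 2) by
          rw [Real.log_pow]; norm_num, Real.exp_log (by norm_num)]; ring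
      rw [e4]; linarith
    exact norm_Usum_le hB hY hL ht hr1 hr2 hr50 rfl halo hahi hνlo hνhi hM hgood hG1 hG2
      (hJ r (5 * r ^ 2) a hr50 hr2 rfl halo)
  -- Vinogradov's shift (the tree's `norm_zetaSum_le_shift`) and the three terms
  have hshift := norm_zetaSum_le_shift r (by omega : 1 ≤ N) hNR hR ht0.le hu0 ha1 haN
  have hsumU : ∑ n ∈ Ioc N R, ‖∑ x ∈ Icc (1 : ℤ) a, ∑ y ∈ Icc (1 : ℤ) a,
      VdC.e (∑ j : Fin r, ((-1) ^ (j.val + 1) * t / (2 * π * (j.val + 1) * ((n : ℝ) + u) ^ (j.val + 1))) *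
        ((x : ℝ) ^ (j.val + 1) * (y : ℝ) ^ (j.val + 1)))‖ ≤
      (N : ℝ) * ((a : ℝ) ^ 2 * Real.exp (B ^ 2 / 2 + 2) * Real.exp (-(2e-6 * L / Y ^ 2))) := by
    have h1 : ∀ n ∈ Ioc N R, ‖∑ x ∈ Icc (1 : ℤ) a, ∑ y ∈ Icc (1 : ℤ) a,
        VdC.e (∑ j : Fin r, ((-1) ^ (j.val + 1) * t / (2 * π * (j.val + 1) * ((n : ℝ) + u) ^ (j.val + 1))) *
          ((x : ℝ) ^ (j.val + 1) * (y : ℝ) ^ (j.val + 1)))‖ ≤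
        (a : ℝ) ^ 2 * Real.exp (B ^ 2 / 2 + 2) * Real.exp (-(2e-6 * L / Y ^ 2)) := by
      intro n hn
      rw [norm_doubleSum_eq_norm_Usum]
      exact hU n hn
    refine (sum_le_sum h1).trans ?_
    rw [sum_const, nsmul_eq_mul, Nat.card_Ioc]
    apply mul_le_mul_of_nonneg_right _ (by positivity)
    exact_mod_cast (by omega : R - N ≤ N)
  have hterm1 : 1 / (a : ℝ) ^ 2 * ((N : ℝ) * ((a : ℝ) ^ 2 * Real.exp (B ^ 2 / 2 + 2) *
      Real.exp (-(2e-6 * L / Y ^ 2)))) = (N : ℝ) * Real.exp (B ^ 2 / 2 + 2) * Real.exp (-(2e-6 * L / Y ^ 2)) := by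
    field_simp
  have hterm2 : 2 * (N : ℝ) * t * ((a : ℝ) ^ 2 / N) ^ (r + 1) ≤ (N : ℝ) * (2 * Real.exp (-(2e-6 * L / Y ^ 2))) := by
    have : 2 * (N : ℝ) * t * ((a : ℝ) ^ 2 / N) ^ (r + 1) = (N : ℝ) * (2 * t * ((a : ℝ) ^ 2 / N) ^ (r + 1)) := by
      ring
    rw [this]
    exact mul_le_mul_of_nonneg_left herr hN0.le
  have hterm3 : 2 * (a : ℝ) ^ 2 ≤ (N : ℝ) * (2 * Real.exp (-(2e-6 * L / Y ^ 2))) := by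
    linarith only [ha2s]
  calc ‖∑ n ∈ Ioc N R, ((n : ℂ) + u) ^ (-(t * I))‖
      ≤ 1 / (a : ℝ) ^ 2 * ((N : ℝ) * ((a : ℝ) ^ 2 * Real.exp (B ^ 2 / 2 + 2) * Real.exp (-(2e-6 * L / Y ^ 2)))) +
          (N : ℝ) * (2 * Real.exp (-(2e-6 * L / Y ^ 2))) + (N : ℝ) * (2 * Real.exp (-(2e-6 * L / Y ^ 2))) := by
        refine hshift.trans (add_le_add (add_le_add ?_ hterm2) hterm3)
        exact mul_le_mul_of_nonneg_left hsumU (by positivity)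
    _ = (Real.exp (B ^ 2 / 2 + 2) + 4) * N * Real.exp (-(2e-6 * L / Y ^ 2)) := by
        rw [hterm1]; ring


/-! ### Ivić's Theorem 6.2 in Vinogradov's range from `VMVTBound A`; the Vinogradov–Korobov region -/

/-- `e^{4.082} ≤ 60`. [folklore] -/
theorem exp_4082_le : Real.exp 4.082 ≤ 60 := by
  have h1 : Real.exp 4.082 = Real.exp 1 ^ 4 * Real.exp 0.082 := by
    rw [← Real.exp_nat_mul, ← Real.exp_add]; norm_num
  have h2 : Real.exp 1 ^ 4 < 2.7182818286 ^ 4 :=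
    pow_lt_pow_left₀ Real.exp_one_lt_d9 (Real.exp_pos _).le (by norm_num)
  have h3 : Real.exp 0.082 < 1 / (1 - 0.082) :=
    Real.exp_bound_div_one_sub_of_interval' (by norm_num) (by norm_num)
  rw [h1]
  have h4 : (2.7182818286 : ℝ) ^ 4 ≤ 54.5982 := by norm_num
  have h5 : (1 : ℝ) / (1 - 0.082) ≤ 1.0894 := by norm_num
  nlinarith [Real.exp_pos 0.082, pow_pos (Real.exp_pos 1) 4]

/-- `(1 + 1/(r−1))^{4r} ≤ 60` for `r ≥ 50` (`≤ e^{4r/(r−1)} ≤ e^{4.082}`). [folklore] -/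
theorem one_add_inv_pow_le {r : ℕ} (hr : 50 ≤ r) : (1 + 1 / ((r : ℝ) - 1)) ^ (4 * r) ≤ 60 := by
  have hr' : (50 : ℝ) ≤ r := by exact_mod_cast hr
  have hx0 : 0 < (r : ℝ) - 1 := by linarith
  have h1 : (1 + 1 / ((r : ℝ) - 1)) ^ (4 * r) ≤ Real.exp (1 / ((r : ℝ) - 1)) ^ (4 * r) := by
    apply pow_le_pow_left₀ (by positivity)
    have := Real.add_one_le_exp (1 / ((r : ℝ) - 1)); linarith
  rw [← Real.exp_nat_mul] at h1
  refine h1.trans (le_trans (Real.exp_le_exp.2 ?_) exp_4082_le)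
  push_cast
  rw [show (4 : ℝ) * r * (1 / ((r : ℝ) - 1)) = 4 * r / ((r : ℝ) - 1) by ring, div_le_iff₀ hx0]
  linarith

/-- **The mean value bound at the parameters used, from `VMVTBound A`**: for `r ≥ 50`, `r ≤ 5.01Y`,
`k = 5r²`, `a ≥ N^{2/5}/2` and `L = log N ≥ 10⁶ A² Y²` (`Y ≥ 10`), the largeness condition
`a ≥ (Ar)^{Ar(1 + 1/(r−1))^{4r}}` of `VMVTBound A` at degree `r`, `4r` iterations holds (the exponent is
`≤ 60Ar`, and `60Ar log(Ar) ≤ 60A²r² ≤ 1507A²Y² ≤ L/500`), so that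
`J_{k,r}(a) ≤ (Ar)^{Ak·4r} a^{…} ≤ (Ar)^{Ak(4r+1)} a^{…}`. [cite: Ivic1985, Lemma 6.3 and (6.44)] -/
theorem J_le_of_vmvt {A : ℝ} (hA : 1 ≤ A) (hV : VMVTBound A) {L Y : ℝ} {r k a : ℕ}
    (hY : 10 ≤ Y) (hL : (10 : ℝ) ^ 6 * A ^ 2 * Y ^ 2 ≤ L) (hr50 : 50 ≤ r) (hr2 : (r : ℝ) ≤ 5.01 * Y)
    (hk : k = 5 * r ^ 2) (halo : Real.exp (0.4 * L - Real.log 2) ≤ a) :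
    (J r k (Icc (1 : ℤ) a) : ℝ) ≤ (A * r) ^ (A * k * (((4 * r : ℕ) : ℝ) + 1)) *
      (a : ℝ) ^ ((2 * k : ℝ) - ((r : ℝ) ^ 2 + r) / 2 + ((r : ℝ) ^ 2 + r) / 2 * (1 - 1 / (r : ℝ)) ^ (4 * r)) := by
  have hr' : (50 : ℝ) ≤ r := by exact_mod_cast hr50
  have hY0 : 0 < Y := by linarith
  have hAr : (1 : ℝ) ≤ A * r := by nlinarith
  have hlog2 := Real.log_two_lt_d9
  have hA2 : 1 ≤ A ^ 2 := by nlinarith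
  have hY2 : 100 ≤ Y ^ 2 := by nlinarith
  have hL8 : (10 : ℝ) ^ 8 ≤ L := by
    have := mul_le_mul hA2 hY2 (by norm_num) (by positivity)
    nlinarith
  -- the largeness condition
  have hlarge : (A * r) ^ (A * r * (1 + 1 / ((r : ℝ) - 1)) ^ (4 * r)) ≤ (a : ℝ) := by
    have h60 := one_add_inv_pow_le hr50
    have h1 : (A * r) ^ (A * r * (1 + 1 / ((r : ℝ) - 1)) ^ (4 * r)) ≤ (A * r) ^ (60 * (A * r)) := by
      apply Real.rpow_le_rpow_of_exponent_le hAr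
      have : 0 ≤ A * r := by positivity
      nlinarith
    have h2 : (A * r) ^ (60 * (A * r)) ≤ Real.exp (60 * (A * r) ^ 2) := by
      rw [Real.rpow_def_of_pos (by positivity)]
      apply Real.exp_le_exp.2
      have hl : Real.log (A * r) ≤ A * r := by
        have := Real.log_le_sub_one_of_pos (by positivity : 0 < A * r); linarith
      have : 0 ≤ A * r := by positivity
      nlinarith
    have h3 : 60 * (A * r) ^ 2 ≤ 0.4 * L - Real.log 2 := by
      have : (A * r) ^ 2 ≤ A ^ 2 * (5.01 * Y) ^ 2 := by
        rw [mul_pow]; apply mul_le_mul_of_nonneg_left _ (sq_nonneg A)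
        exact pow_le_pow_left₀ (by positivity) hr2 2
      nlinarith
    exact h1.trans (h2.trans ((Real.exp_le_exp.2 h3).trans halo))
  have h := hV r (4 * r) k a (by omega) (by rw [hk]; ring_nf; omega) hlarge
  refine h.trans ?_
  have ha0 : (0 : ℝ) < a := lt_of_lt_of_le (Real.exp_pos _) halo
  apply mul_le_mul _ (le_of_eq ?_) (by positivity) (by positivity)
  · apply Real.rpow_le_rpow_of_exponent_le hAr
    push_cast
    have : 0 ≤ A * k := by positivity
    nlinarith
  · congr 1; ring

set_option maxHeartbeats 400000 in
/-- **Ivić's Theorem 6.2 (shifted, Vinogradov's range) from the large-`P` form of the mean value theorem**: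
`VMVTBound A` (`A ≥ 1`; the tree's interface of `VinogradovMeanValueHypothesis.lean`, Ivić's Lemma 6.3 being
`A = 4`) implies `VinogradovRangeBound 10 (e^{A²+2} + 4) 10⁻⁶`: `norm_zetaSum_le_main` with the
main range cut at `log N ≥ 10⁶ A² (log t/log N)²` so that `a = [N^{2/5}]` is large enough for `VMVTBound A`
(`J_le_of_vmvt`); below it the estimate is trivial since `e^{A²} N^{−10⁻⁶ log²N/log²t} ≥ 1`.
[cite: Ivic1985, Theorem 6.2] -/
theorem vinogradovRangeBound_of_vmvt {A : ℝ} (hA : 1 ≤ A) (hV : VMVTBound A) :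
    VinogradovRangeBound 10 (Real.exp (A ^ 2 + 2) + 4) 1e-6 := by
  intro N R t u hN hNt hu0 hu1 hNR hR
  have hN0 : (0 : ℝ) < N := by exact_mod_cast (by omega : 0 < N)
  have hN1 : (1 : ℝ) ≤ N := by exact_mod_cast hN
  have hA2 : Real.exp (A ^ 2) ≤ Real.exp (A ^ 2 + 2) := Real.exp_le_exp.2 (by linarith)
  have hhalf : Real.exp (A ^ 2 / 2 + 2) ≤ Real.exp (A ^ 2 + 2) := Real.exp_le_exp.2 (by nlinarith)
  -- the trivial bound
  have htriv : ‖∑ n ∈ Ioc N R, ((n : ℂ) + u) ^ (-(t * I))‖ ≤ N := by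
    refine (norm_sum_le _ _).trans ?_
    have : ∑ n ∈ Ioc N R, ‖((n : ℂ) + u) ^ (-(t * I))‖ = ((R - N : ℕ) : ℝ) := by
      simp [natCast_add_cpow_eq_e hu0, VdC.norm_e]
    rw [this]
    exact_mod_cast (by omega : R - N ≤ N)
  have ht1 : 1 ≤ t := le_trans (Real.one_le_rpow hN1 (by norm_num)) hNt
  have hlt0 : 0 ≤ Real.log t := Real.log_nonneg ht1
  set L := Real.log N with hLdef
  have hL0 : 0 ≤ L := Real.log_nonneg hN1
  have hrhs : (N : ℝ) ^ (1 - 1e-6 * L ^ 2 / Real.log t ^ 2) =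
      N * Real.exp (-(1e-6 * L ^ 3 / Real.log t ^ 2)) := by
    rw [Real.rpow_def_of_pos hN0, ← hLdef]
    conv_rhs => rw [← Real.exp_log hN0, ← hLdef, ← Real.exp_add]
    congr 1; ring
  rw [hrhs]
  by_cases hmain : 2 ≤ N ∧ (10 : ℝ) ^ 6 * A ^ 2 * (Real.log t / L) ^ 2 ≤ L
  · -- the main range
    obtain ⟨hN2, hmain⟩ := hmain
    have hmain' : (10 : ℝ) ^ 6 * (Real.log t / L) ^ 2 ≤ L := by
      have hA2 : 1 ≤ A ^ 2 := by nlinarith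
      have : (Real.log t / L) ^ 2 ≤ A ^ 2 * (Real.log t / L) ^ 2 := by
        have := mul_le_mul_of_nonneg_right hA2 (sq_nonneg (Real.log t / L))
        linarith
      nlinarith
    have hL0' : 0 < L := Real.log_pos (by exact_mod_cast hN2)
    have hlt : 0 < Real.log t := by
      have h2 : (1 : ℝ) < N := by exact_mod_cast hN2
      exact Real.log_pos (lt_of_lt_of_le (Real.one_lt_rpow h2 (by norm_num)) hNt)
    have hY10 : 10 ≤ Real.log t / L := by
      have h1 := Real.log_le_log (Real.rpow_pos_of_pos hN0 _) hNt
      rw [Real.log_rpow hN0, ← hLdef] at h1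
      rw [le_div_iff₀ hL0']; linarith
    have h := norm_zetaSum_le_main hA hN2 (by simpa using hNt) hu0 hu1 hNR hR hmain'
      (fun r k a hr50 hr2 hk halo => J_le_of_vmvt hA hV hY10 hmain hr50 hr2 hk halo)
    rw [← hLdef] at h
    refine h.trans ?_
    have e1 : 2e-6 * L / (Real.log t / L) ^ 2 = 2 * (1e-6 * L ^ 3 / Real.log t ^ 2) := by
      field_simp; ring
    rw [e1, mul_assoc]
    apply mul_le_mul (by linarith) _ (by positivity) (by positivity)
    apply mul_le_mul_of_nonneg_left _ hN0.le
    apply Real.exp_le_exp.2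
    have : 0 ≤ 1e-6 * L ^ 3 / Real.log t ^ 2 := by positivity
    linarith
  · -- the trivial range
    refine htriv.trans ?_
    have hexp : Real.exp (-A ^ 2) ≤ Real.exp (-(1e-6 * L ^ 3 / Real.log t ^ 2)) := by
      apply Real.exp_le_exp.2
      rw [neg_le_neg_iff]
      rcases Nat.lt_or_ge N 2 with hN2 | hN2
      · have : N = 1 := by omega
        subst this
        simp [hLdef]; positivity
      · have hL0' : 0 < L := Real.log_pos (by exact_mod_cast hN2)
        have hnot : L < (10 : ℝ) ^ 6 * A ^ 2 * (Real.log t / L) ^ 2 := by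
          by_contra h; exact hmain ⟨hN2, not_lt.1 h⟩
        rcases eq_or_lt_of_le hlt0 with hlt | hlt
        · rw [← hlt]; simp; positivity
        · have h3 : L ^ 3 < (10 : ℝ) ^ 6 * A ^ 2 * Real.log t ^ 2 := by
            have := mul_lt_mul_of_pos_right hnot (pow_pos hL0' 2)
            rwa [show (10 : ℝ) ^ 6 * A ^ 2 * (Real.log t / L) ^ 2 * L ^ 2 = (10 : ℝ) ^ 6 * A ^ 2 * Real.log t ^ 2 by
              field_simp, show L * L ^ 2 = L ^ 3 by ring] at this
          rw [div_le_iff₀ (by positivity)]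
          norm_num at h3 ⊢
          nlinarith [sq_nonneg A]
    have h1 : (N : ℝ) * Real.exp (-A ^ 2) * (Real.exp (A ^ 2 + 2) + 4) ≥ N := by
      have h2 : 1 ≤ Real.exp (-A ^ 2) * (Real.exp (A ^ 2 + 2) + 4) := by
        rw [Real.exp_neg, le_inv_mul_iff₀ (Real.exp_pos _)]
        linarith
      nlinarith
    calc (N : ℝ) ≤ (N : ℝ) * Real.exp (-A ^ 2) * (Real.exp (A ^ 2 + 2) + 4) := h1
      _ ≤ (N : ℝ) * Real.exp (-(1e-6 * L ^ 3 / Real.log t ^ 2)) * (Real.exp (A ^ 2 + 2) + 4) := by gcongr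
      _ = (Real.exp (A ^ 2 + 2) + 4) * (N * Real.exp (-(1e-6 * L ^ 3 / Real.log t ^ 2))) := by ring

/-- `VMVTBound A ⟹ ∃ C D, ExpSumBound C D`. [cite: Ivic1985, Theorem 6.2] [cite: Ford2002, Theorem 2] -/
theorem expSumBound_of_vmvt {A : ℝ} (hA : 1 ≤ A) (hV : VMVTBound A) :
    ∃ C D : ℝ, 0 ≤ C ∧ 0 < D ∧ ExpSumBound C D :=
  expSumBound_of_vinogradovRange (by norm_num) (by positivity) (by norm_num) (vinogradovRangeBound_of_vmvt hA hV)

/-- **`VMVTBound A` (`A ≥ 1`) ⟹ the Vinogradov–Korobov zero-free region for all Dirichlet `L`-functions**,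
`∃ c > 0, HasVKZeroFreeRegion c 21`; with the tree's `VMVTBound 4` (Ivić's Lemma 6.3, being proved bottom-up
in `VinogradovMeanValue*.lean`) this closes the chain from Vinogradov's mean value theorem to the twisted prime
number theorem and its users. [cite: Ivic1985, Theorems 6.1–6.2 and Lemma 6.3] [cite: Khale2024, (1.4)] -/
theorem hasVKZeroFreeRegion_of_vmvt {A : ℝ} (hA : 1 ≤ A) (hV : VMVTBound A) :
    ∃ c : ℝ, 0 < c ∧ HasVKZeroFreeRegion c 21 :=
  hasVKZeroFreeRegion_of_vinogradovRange (by norm_num) (by positivity) (by norm_num)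
    (vinogradovRangeBound_of_vmvt hA hV)

/-! ### Unconditionally: the tree's Lemma 6.3 (`VMV.lemma63`) at the parameters used -/

open VMV (C62 K63 cr one_le_K63 two_le_C62)

/-- `log 9 ≤ 3`. [folklore] -/
theorem log_nine_le : Real.log 9 ≤ 3 := by
  rw [Real.log_le_iff_le_exp (by norm_num)]
  have h := Real.exp_one_gt_d9
  have : Real.exp 3 = Real.exp 1 ^ 3 := by rw [← Real.exp_nat_mul]; norm_num
  rw [this]
  have h3 : (2.7182818283 : ℝ) ^ 3 ≤ Real.exp 1 ^ 3 := pow_le_pow_left₀ (by norm_num) h.le 3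
  have h9 : (9 : ℝ) ≤ (2.7182818283 : ℝ) ^ 3 := by norm_num
  linarith

/-- `log 5 ≤ 2`. [folklore] -/
theorem log_five_le : Real.log 5 ≤ 2 := by
  rw [Real.log_le_iff_le_exp (by norm_num)]
  have h := Real.exp_one_gt_d9
  have : Real.exp 2 = Real.exp 1 ^ 2 := by rw [← Real.exp_nat_mul]; norm_num
  rw [this]
  have h3 : (2.7182818283 : ℝ) ^ 2 ≤ Real.exp 1 ^ 2 := pow_le_pow_left₀ (by norm_num) h.le 2
  have h9 : (5 : ℝ) ≤ (2.7182818283 : ℝ) ^ 2 := by norm_num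
  linarith

/-- `log 3 ≤ 3`. [folklore] -/
theorem log_three_le : Real.log 3 ≤ 3 :=
  (Real.log_le_log (by norm_num) (by norm_num : (3 : ℝ) ≤ 9)).trans log_nine_le

/-- `C₆₂(r, 5r²) ≤ 3 (5r²)^{2r} r^r 2^{r²} 9^r` (`r! ≤ r^r`, `3^r ≤ 9^r`). [folklore] -/
theorem C62_le (r : ℕ) (hr : 1 ≤ r) :
    C62 r (5 * r ^ 2) ≤ 3 * (((5 * r ^ 2 : ℕ) : ℝ) ^ (2 * r) * (r : ℝ) ^ r * 2 ^ (r * r) * 9 ^ r) := by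
  unfold C62
  have hr' : (1 : ℝ) ≤ r := by exact_mod_cast hr
  have h5 : (1 : ℝ) ≤ ((5 * r ^ 2 : ℕ) : ℝ) := by push_cast; nlinarith
  have hfact : ((Nat.factorial r : ℕ) : ℝ) ≤ (r : ℝ) ^ r := by exact_mod_cast Nat.factorial_le_pow r
  have h1 : (9 : ℝ) ^ r ≤ ((5 * r ^ 2 : ℕ) : ℝ) ^ (2 * r) * (r : ℝ) ^ r * 2 ^ (r * r) * 9 ^ r := by
    have : (1 : ℝ) ≤ ((5 * r ^ 2 : ℕ) : ℝ) ^ (2 * r) * (r : ℝ) ^ r * 2 ^ (r * r) := by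
      have a1 := one_le_pow₀ (M₀ := ℝ) h5 (n := 2 * r)
      have a2 := one_le_pow₀ (M₀ := ℝ) hr' (n := r)
      have a3 : (1 : ℝ) ≤ 2 ^ (r * r) := one_le_pow₀ (by norm_num)
      calc (1 : ℝ) = 1 * 1 * 1 := by ring
        _ ≤ _ := by gcongr
    nlinarith [pow_pos (by norm_num : (0:ℝ) < 9) r]
  have h2 : ((5 * r ^ 2 : ℕ) : ℝ) ^ (2 * r) * (Nat.factorial r) * 2 ^ (r * r) * 3 ^ r ≤
      ((5 * r ^ 2 : ℕ) : ℝ) ^ (2 * r) * (r : ℝ) ^ r * 2 ^ (r * r) * 9 ^ r := by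
    have h39 : (3 : ℝ) ^ r ≤ 9 ^ r := pow_le_pow_left₀ (by norm_num) (by norm_num) r
    gcongr
  linarith

/-- **The constant of the tree's Lemma 6.3 at the parameters used**: `K(r,5r²)^{4r} r^{2r²(r+1)} ≤
(4r)^{4·5r²·(4r+1)}` for `r ≥ 50` (`VMV.K63`, `VMV.C62` of `VinogradovMeanValueBound.lean`; logarithms:
`4r log K + 2r²(r+1) log r ≤ 64r³ + 20r² log r + … ≤ 80r³(log 4 + log r)`). [cite: Ivic1985, Lemma 6.3 and (6.44)] -/
theorem K63_instance_le {r : ℕ} (hr : 50 ≤ r) :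
    K63 r (5 * r ^ 2) ^ (4 * r) * (r : ℝ) ^ (2 * r ^ 2 * (r + 1)) ≤
      ((4 : ℝ) * r) ^ ((4 : ℝ) * ((5 * r ^ 2 : ℕ) : ℝ) * (((4 * r : ℕ) : ℝ) + 1)) := by
  have hr1 : 1 ≤ r := by omega
  have hrR : (50 : ℝ) ≤ r := by exact_mod_cast hr
  have hr0 : (0 : ℝ) < r := by linarith
  have hK1 := one_le_K63 r (5 * r ^ 2)
  have hK0 : 0 < K63 r (5 * r ^ 2) := by linarith
  -- logs
  have hlog2 := Real.log_two_lt_d9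
  have hlog2' := Real.log_two_gt_d9
  have hlog9 := log_nine_le
  have hlog5 := log_five_le
  have hlogr : 0 ≤ Real.log r := Real.log_nonneg (by linarith)
  have hlogr' : Real.log r ≤ r := by linarith [Real.log_le_sub_one_of_pos hr0]
  -- log K63 ≤ …
  have hC := C62_le r hr1
  have hlogK : Real.log (K63 r (5 * r ^ 2)) ≤
      ((5 * r ^ 2 : ℕ) : ℝ) * Real.log 9 + (Real.log 3 + (2 * r * Real.log ((5 * r ^ 2 : ℕ) : ℝ) +
        r * Real.log r + (r * r) * Real.log 2 + r * Real.log 9)) := by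
    unfold K63
    have hpos : (0 : ℝ) < 3 * (((5 * r ^ 2 : ℕ) : ℝ) ^ (2 * r) * (r : ℝ) ^ r * 2 ^ (r * r) * 9 ^ r) := by positivity
    have hC0 : 0 < C62 r (5 * r ^ 2) := by linarith [two_le_C62 r (5 * r ^ 2)]
    rw [Real.log_mul (by positivity) hC0.ne', Real.log_pow]
    refine add_le_add le_rfl ?_
    refine (Real.log_le_log hC0 hC).trans (le_of_eq ?_)
    rw [Real.log_mul (by norm_num) (by positivity), Real.log_mul (by positivity) (by positivity),
      Real.log_mul (by positivity) (by positivity), Real.log_mul (by positivity) (by positivity),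
      Real.log_pow, Real.log_pow, Real.log_pow, Real.log_pow]
    push_cast; ring
  have hlog5r : Real.log ((5 * r ^ 2 : ℕ) : ℝ) ≤ 2 + 2 * Real.log r := by
    push_cast
    rw [Real.log_mul (by norm_num) (by positivity), Real.log_pow]; push_cast; linarith
  -- the comparison of logarithms
  have hlhs : Real.log (K63 r (5 * r ^ 2) ^ (4 * r) * (r : ℝ) ^ (2 * r ^ 2 * (r + 1))) =
      (4 * r) * Real.log (K63 r (5 * r ^ 2)) + (2 * r ^ 2 * (r + 1)) * Real.log r := by
    rw [Real.log_mul (by positivity) (by positivity), Real.log_pow, Real.log_pow]; push_cast; ring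
  have hrhs : Real.log (((4 : ℝ) * r) ^ ((4 : ℝ) * ((5 * r ^ 2 : ℕ) : ℝ) * (((4 * r : ℕ) : ℝ) + 1))) =
      (4 * (5 * r ^ 2) * (4 * r + 1)) * (Real.log 4 + Real.log r) := by
    rw [Real.log_rpow (by positivity), Real.log_mul (by norm_num) hr0.ne']; push_cast; ring
  have hlog4 : 1.38 ≤ Real.log 4 := by
    rw [show (4 : ℝ) = 2 ^ 2 by norm_num, Real.log_pow]; push_cast; linarith
  rw [← Real.log_le_log_iff (by positivity) (by positivity), hlhs, hrhs]
  have h5r : ((5 * r ^ 2 : ℕ) : ℝ) = 5 * (r : ℝ) ^ 2 := by push_cast; ring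
  rw [h5r] at hlogK hlog5r
  have hr2 : (2500 : ℝ) ≤ (r : ℝ) ^ 2 := by nlinarith
  -- bound `log K`
  have hK' : Real.log (K63 r (5 * r ^ 2)) ≤ 16 * r ^ 2 + 5 * r * Real.log r + 7 * r := by
    have a1 := mul_le_mul_of_nonneg_left hlog5r (by positivity : (0 : ℝ) ≤ 2 * r)
    have a2 := mul_le_mul_of_nonneg_left hlog9 (by positivity : (0 : ℝ) ≤ 5 * (r : ℝ) ^ 2)
    have a3 := mul_le_mul_of_nonneg_left hlog9 (by positivity : (0 : ℝ) ≤ (r : ℝ))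
    have a4 := mul_le_mul_of_nonneg_left hlog2.le (by positivity : (0 : ℝ) ≤ (r : ℝ) * r)
    have a5 := log_three_le
    nlinarith [a1, a2, a3, a4, a5]
  -- compare
  have h1 := mul_le_mul_of_nonneg_left hK' (by positivity : (0 : ℝ) ≤ 4 * r)
  have h2 := mul_le_mul_of_nonneg_left hlog4 (by positivity : (0 : ℝ) ≤ 4 * (5 * (r : ℝ) ^ 2) * (4 * r + 1))
  have hr3 : 50 * (r : ℝ) ^ 2 ≤ (r : ℝ) ^ 3 := by nlinarith
  have h4 : 50 * (r : ℝ) ^ 2 * Real.log r ≤ (r : ℝ) ^ 3 * Real.log r := mul_le_mul_of_nonneg_right hr3 hlogr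
  have n1 : 0 ≤ (r : ℝ) ^ 2 * Real.log r := by positivity
  have n2 : 0 ≤ (r : ℝ) ^ 3 * Real.log r := by positivity
  nlinarith [h1, h2, hr3, h4, n1, n2]


/-- **The mean value theorem at the parameters used** (degree `r ≥ 50`, `k = 5r²`, `4r` iterations, any
`P = a ≥ 1`), from the tree's `VMV.lemma63_five_sq` (Ivić's Lemma 6.3, proved for all `P ≥ 1` in
`VinogradovMeanValueBound.lean`) and `K63_instance_le`:
`J_{5r²,r}(a) ≤ (4r)^{4·5r²(4r+1)} a^{10r² − (r²+r)/2 + ½(r²+r)(1−1/r)^{4r}}`. [cite: Ivic1985, Lemma 6.3 and (6.44)] -/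
theorem J_le_four {r k a : ℕ} (hr : 50 ≤ r) (ha : 1 ≤ a) (hk : k = 5 * r ^ 2) :
    (J r k (Icc (1 : ℤ) a) : ℝ) ≤ ((4 : ℝ) * r) ^ ((4 : ℝ) * k * (((4 * r : ℕ) : ℝ) + 1)) *
      (a : ℝ) ^ ((2 * k : ℝ) - ((r : ℝ) ^ 2 + r) / 2 + ((r : ℝ) ^ 2 + r) / 2 * (1 - 1 / (r : ℝ)) ^ (4 * r)) := by
  subst hk
  have h := VMV.lemma63_five_sq (n := r) (by omega) ha
  have hK := K63_instance_le hr
  have ha0 : (0 : ℝ) ≤ a := by positivity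
  have e : (2 * ((5 * r ^ 2 : ℕ) : ℝ) - ((r : ℝ) ^ 2 + r) / 2 + cr r (4 * r)) =
      ((2 * ((5 * r ^ 2 : ℕ) : ℝ) : ℝ) - ((r : ℝ) ^ 2 + r) / 2 + ((r : ℝ) ^ 2 + r) / 2 * (1 - 1 / (r : ℝ)) ^ (4 * r)) := by
    unfold VMV.cr; ring
  rw [e] at h
  refine h.trans ?_
  push_cast at hK ⊢
  exact mul_le_mul_of_nonneg_right hK (by positivity)

set_option maxHeartbeats 400000 in
/-- **Ivić's Theorem 6.2 for the shifted zeta sums in Vinogradov's range, UNCONDITIONALLY**: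
`VinogradovRangeBound 10 (e^{10} + 4) 10⁻⁶`, i.e. `‖∑_{N<n≤R} (n+u)^{-it}‖ ≤ (e^{10} + 4) N^{1 − 10⁻⁶ log²N/log²t}`
for `1 ≤ N < R ≤ 2N`, `N^{21/2} ≤ t`, `0 < u ≤ 1` — `norm_zetaSum_le_main` with `B = 4` and the tree's Lemma 6.3
(`J_le_four`); trivial below `log N = 10⁶ (log t/log N)²`.  (Ivić: `∑_{N<n≤N₁≤2N} n^{it} ≪ N exp(−log³N/(10⁵ log²t))`.)
[cite: Ivic1985, Theorem 6.2] -/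
theorem vinogradovRangeBound_ivic : VinogradovRangeBound 10 (Real.exp 10 + 4) 1e-6 := by
  have hB : (1 : ℝ) ≤ 4 := by norm_num
  have h10 : Real.exp ((4 : ℝ) ^ 2 / 2 + 2) = Real.exp 10 := by norm_num
  rw [← h10]
  intro N R t u hN hNt hu0 hu1 hNR hR
  have hN0 : (0 : ℝ) < N := by exact_mod_cast (by omega : 0 < N)
  have hN1 : (1 : ℝ) ≤ N := by exact_mod_cast hN
  have hCe : Real.exp 1 ≤ Real.exp ((4 : ℝ) ^ 2 / 2 + 2) := Real.exp_le_exp.2 (by norm_num)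
  have he1 : (1 : ℝ) ≤ Real.exp 1 := by have := Real.add_one_le_exp (1 : ℝ); linarith
  -- the trivial bound
  have htriv : ‖∑ n ∈ Ioc N R, ((n : ℂ) + u) ^ (-(t * I))‖ ≤ N := by
    refine (norm_sum_le _ _).trans ?_
    have : ∑ n ∈ Ioc N R, ‖((n : ℂ) + u) ^ (-(t * I))‖ = ((R - N : ℕ) : ℝ) := by
      simp [natCast_add_cpow_eq_e hu0, VdC.norm_e]
    rw [this]
    exact_mod_cast (by omega : R - N ≤ N)
  -- `t > 1`
  have ht1 : 1 ≤ t := by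
    refine le_trans ?_ hNt
    exact Real.one_le_rpow hN1 (by norm_num)
  have hlt0 : 0 ≤ Real.log t := Real.log_nonneg ht1
  set L := Real.log N with hLdef
  have hL0 : 0 ≤ L := Real.log_nonneg hN1
  -- the right-hand side as `N · exp(−10⁻⁶ L³/log²t)`
  have hrhs : (N : ℝ) ^ (1 - 1e-6 * L ^ 2 / Real.log t ^ 2) =
      N * Real.exp (-(1e-6 * L ^ 3 / Real.log t ^ 2)) := by
    rw [Real.rpow_def_of_pos hN0, ← hLdef]
    conv_rhs => rw [← Real.exp_log hN0, ← hLdef, ← Real.exp_add]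
    congr 1; ring
  rw [hrhs]
  by_cases hmain : 2 ≤ N ∧ (10 : ℝ) ^ 6 * (Real.log t / L) ^ 2 ≤ L
  · -- the main range
    obtain ⟨hN2, hmain⟩ := hmain
    have h := norm_zetaSum_le_main hB hN2 (by simpa using hNt) hu0 hu1 hNR hR hmain
      (fun r k a hr50 _ hk halo => J_le_four hr50 (Nat.one_le_iff_ne_zero.2 (by
          rintro rfl
          have : (0 : ℝ) < ((0 : ℕ) : ℝ) := lt_of_lt_of_le (Real.exp_pos _) halo
          simp at this)) hk)
    rw [← hLdef] at h
    refine h.trans ?_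
    have hL0' : 0 < L := Real.log_pos (by exact_mod_cast hN2)
    have hlt : 0 < Real.log t := by
      have h2 : (1 : ℝ) < N := by exact_mod_cast hN2
      have : (1 : ℝ) < t := lt_of_lt_of_le (Real.one_lt_rpow h2 (by norm_num)) hNt
      exact Real.log_pos this
    have e1 : 2e-6 * L / (Real.log t / L) ^ 2 = 2 * (1e-6 * L ^ 3 / Real.log t ^ 2) := by
      field_simp; ring
    rw [e1, mul_assoc]
    apply mul_le_mul_of_nonneg_left _ (by positivity)
    apply mul_le_mul_of_nonneg_left _ hN0.le
    apply Real.exp_le_exp.2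
    have : 0 ≤ 1e-6 * L ^ 3 / Real.log t ^ 2 := by positivity
    linarith
  · -- the trivial range: `‖S‖ ≤ N ≤ C N e^{-1} ≤ C N exp(−10⁻⁶L³/log²t)`
    refine htriv.trans ?_
    have hexp : Real.exp (-1) ≤ Real.exp (-(1e-6 * L ^ 3 / Real.log t ^ 2)) := by
      apply Real.exp_le_exp.2
      rw [neg_le_neg_iff]
      rcases Nat.lt_or_ge N 2 with hN2 | hN2
      · have : N = 1 := by omega
        subst this
        simp [hLdef]
      · have hL0' : 0 < L := Real.log_pos (by exact_mod_cast hN2)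
        have hnot : L < (10 : ℝ) ^ 6 * (Real.log t / L) ^ 2 := by
          by_contra h; exact hmain ⟨hN2, not_lt.1 h⟩
        rcases eq_or_lt_of_le hlt0 with hlt | hlt
        · rw [← hlt]; simp
        · have h3 : L ^ 3 < (10 : ℝ) ^ 6 * Real.log t ^ 2 := by
            have := mul_lt_mul_of_pos_right hnot (pow_pos hL0' 2)
            rwa [show (10 : ℝ) ^ 6 * (Real.log t / L) ^ 2 * L ^ 2 = (10 : ℝ) ^ 6 * Real.log t ^ 2 by
              field_simp, show L * L ^ 2 = L ^ 3 by ring] at this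
          rw [div_le_one (by positivity)]
          norm_num at h3 ⊢
          linarith
    have h1 : (N : ℝ) * Real.exp (-1) * (Real.exp ((4 : ℝ) ^ 2 / 2 + 2) + 4) ≥ N := by
      have h2 : 1 ≤ Real.exp (-1) * (Real.exp ((4 : ℝ) ^ 2 / 2 + 2) + 4) := by
        rw [Real.exp_neg]
        rw [le_inv_mul_iff₀ (Real.exp_pos 1)]
        linarith
      nlinarith
    calc (N : ℝ) ≤ (N : ℝ) * Real.exp (-1) * (Real.exp ((4 : ℝ) ^ 2 / 2 + 2) + 4) := h1
      _ ≤ (N : ℝ) * Real.exp (-(1e-6 * L ^ 3 / Real.log t ^ 2)) * (Real.exp ((4 : ℝ) ^ 2 / 2 + 2) + 4) := by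
          gcongr
      _ = (Real.exp ((4 : ℝ) ^ 2 / 2 + 2) + 4) * (N * Real.exp (-(1e-6 * L ^ 3 / Real.log t ^ 2))) := by ring


/-- **Vinogradov's estimate in Ford's shape, unconditionally**: `∃ C ≥ 0, D > 0, ExpSumBound C D`, i.e.
`‖∑_{N<n≤R}(n+u)^{-it}‖ ≤ C N^{1 − log²N/(D log²t)}` for all `1 ≤ N ≤ t` (the bounded range being van der
Corput's, `expSumBound_of_vinogradovRange`). [cite: Ivic1985, Theorem 6.2] [cite: Ford2002, Theorem 2] -/
theorem expSumBound_ivic : ∃ C D : ℝ, 0 ≤ C ∧ 0 < D ∧ ExpSumBound C D :=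
  expSumBound_of_vinogradovRange (by norm_num) (by positivity) (by norm_num) vinogradovRangeBound_ivic

/-- **The Vinogradov–Korobov zero-free region for all Dirichlet `L`-functions, unconditionally**:
`∃ c > 0, HasVKZeroFreeRegion c 21`, i.e. for every `q ≥ 3`, every Dirichlet character `χ` mod `q`, `|t| ≥ 21` and
`σ ≥ 1 − c/(log q + (log|t|)^{2/3}(log log|t|)^{1/3})`: `L(σ + it, χ) ≠ 0` — Ivić's Theorem 6.1 / Khale's (1.4)
(Montgomery, *Ten lectures*, p. 176) with an inexplicit constant, through the tree's proved chain
`VinogradovRangeBound → ExpSumBound → Richert-type bounds → zero-free region` and the tree's Vinogradov mean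
value theorem (`VinogradovMeanValue*.lean`).  This discharges the hypothesis `HasVKZeroFreeRegion c T₀` of the
twisted prime number theorem (`TwistedVonMangoldtSum.lean`) and of its users (`…_of_vk` theorems of the tree).
[cite: Ivic1985, Theorems 6.1–6.2 and Lemma 6.3] [cite: Khale2024, (1.4) and Theorem B.1] -/
theorem exists_hasVKZeroFreeRegion : ∃ c : ℝ, 0 < c ∧ HasVKZeroFreeRegion c 21 :=
  hasVKZeroFreeRegion_of_vinogradovRange (by norm_num) (by positivity) (by norm_num) vinogradovRangeBound_ivic

end VKZeta
end Literature.NumberTheory.LFunctions
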